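import Literature.MathematicalPhysics.QuantumFieldTheory.Federbush1986.PeelingEstimate
import Literature.MathematicalPhysics.QuantumFieldTheory.Federbush1986.LocalStabilityGFourAverages
import Literature.MathematicalPhysics.QuantumFieldTheory.Federbush1986.AxialGaugeEq524SU2

/-!
# Federbush [F3] §5.3 5) p. 304 «3), and 4) specify a gauge. In this gauge we deduce an inequality like (5.24)»: the small-field
# linearisation (5.22)–(5.24) PROVED IN EVERY PEELABLE GAUGE and for every group carrying §1's chart data — (5.23) is the abelian
# solution of the peeling, (5.24) (`AxialGaugeLinearisation.Eq524Le`, the decl of record of row F3.Eq5.24) its quadratic remainder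

statement-level skeleton of published theorems with citation tags; proofs where landed; nothing here is a claim about the Yang–Mills mass gap

SOURCE. [Federbush1987PhaseCellIII] P. Federbush, *A phase cell approach to Yang–Mills theory III. Local stability, modified
renormalization group transformation*, Commun. Math. Phys. **110** (1987) 293–309 (held `paper:url-4700a514f365`; pp. 300–304 =
PDF pp. 8–12 read this session).  §5.2 p. 302: *«We note at the small field limit, the relation between A_{b_α} and A_{∂p_i}, where
g_{b_α} = e^{A_{b_α}} is group element assigned to bond b_α of the r + 1 lattice (the portion we are considering)
A_{∂p_i} = Σ_α M_{iα}A_{b_α}. (5.22)  The right side is the first term in a power series convergent for small fields. Since the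
Balaban gauge provides a complete gauge specification we have in the small field region (with A_{∂p_i}, i ∈ J, a linearly
independent set) A_{b_α} = Σ_{i∈J} N_{αi}A_{∂p_i} (5.23) (for bonds b_α not assigned ε by the gauge). By the inverse function theorem
we have for A_{∂p_i} small enough (depending on N), |A_{b_α} − Σ_i N_{αi}A_{∂p_i}| < cΣ|A_{∂p_i}|². (5.24)  This estimate will
enable us to control all corrections to steps in the small field proof.»*  §5.3 p. 303: *«A number of constants arise that in
general will depend on the positions of the l.f. plaquettes. Since there are only a finite number of positions for the l.f.
plaquettes, we may choose the constants independent of l.f. plaquette positions by maximizing or minimizing over a finite set, and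
we do so. Some of the constants will depend on N»*; 2)–3) *«Observation. In a simply connected lattice, if the bonds in a maximal
tree are assigned the identity as a choice of gauge, then the bond variables are uniquely determined by the plaquette variables.
3) … We assign ε to a sufficient number of additional bonds to define an axial gauge in each nice block.»*; p. 304 5): *«3), and
4) specify a gauge. In this gauge we deduce an inequality like (5.24), with both sums over only s.f. plaquettes.»*

CITATION HEADER (lean-in-tree rule).  lit-balaban cell (HOME `run/shared/lean/pub/lit-balaban/`), Phase-2 proof seat p26 (gen 15;
free-target protocol G.5-34(d), TAKING HOME/STATUS 2026-08-22T10:47Z), SKELETON rows **F3.Eq5.24** (decl of record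
`AxialGaugeLinearisation.Eq524Le`, statement file `LocalStability.lean` r17 p239010/p243556 UNCHANGED; corrected non-strict reading and
the two MODEL INSTANCES `CombGauge.eq524Le_combStrip` / `CombBlock.eq524Le_combBlock` — `G = SU(2)`, comb gauge of a strip / of a
block — by p32 g4, p248407/p248977) and **F3.Eq5.26-5.40** §5.3 step 5) (owner r17, referee ref-5, head `absent`).  Companions BY NAME
(none edited): this seat's Observation thread — `PeelingObservation` (p313427: `Peeling`, the elimination order «one plaquette with
three known sides determines the fourth»), `PeelingEstimate` (p315145/p315858: the GROUP-level Lipschitz form `d(u_b,u′_b) ≦ W(b)`,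
generic constant `(3^{rank+1}−1)/2`), `NiceSublatticePeeling` (p326242: the nice block sublattice of every family of balls of total
size < block is peelable), `SpanningForestGauge` (p322592); p32's `LocalLogChart` (gen 8: §1's chart data `LocalLog G 𝔤`, instances
`SU2.localLog`, `UN.localLog`) and `LocalStabilityGFourAverages` (`LocalLog.norm_log_wordHol_sub_wordSum_le`: a contour variable is
its abelian sum to first order — the iterated Baker–Campbell–Hausdorff step).

WHAT IS PROVED (generic lattice `ℤ^d`, every `d`; ANY peeling `π` of a bond set `Λ` relative to tree bonds `T` and plaquettes `P`;
EVERY group `G` with a bi-invariant distance and §1's chart data `L : LocalLog G 𝔤` — exponential, local logarithm of radius `ρ`,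
first-order BCH with cubic constant `K`):
* §1–§2 `otherLetters` (the three letters of `∂p` off a given side, oriented form of `PeelingEstimate.otherSides`),
  `wordSum_eq_lsgn_smul_add`, and **`norm_log_side_sub_le`** — ONE PLAQUETTE AT THE LIE-ALGEBRA LEVEL: if `b` is a side of the
  genuine square `p` with letter `±` and `|g_{∂p}| + Σ_{other sides}|u_s| ≦ t ≦ ρ`, then `|u_b| ≦ t` and
  `‖log u_b ∓ (log g_{∂p} − Σ_{other letters} ±log u_s)‖ ≦ t² + 32Kt³` (the relation `g_{∂p} = u₁u₂u₃⁻¹u₄⁻¹` solved for `b`, read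
  through the chart: `norm_log_mul₄_sub_le`).
* §3 **the abelian solution (5.23) of a peeling**: `Peeling.N` — the matrix `N_{αi}` (coefficient of the attached plaquette
  variable `A_{∂p(i)}` in `A_α`), built by the staged elimination `Peeling.Nst` (stage `n` is final on bonds of rank `< n`:
  `Nst_succ_eq`, `Nst_eq_of_le`); the elimination identity `N_eq` (`N_{bi} = ±(δ_{ib} − Σ_{other letters s}±N_{si})`), the plaquette
  relations **`wordSum_N_loop`** (`Σ_{letters s of ∂p(j)} ±N_{si} = δ_{ij}`), the first-order bond variables
  `Peeling.lin Fs A b = Σ_{i∈Fs} N_{bi} • A_i` with `lin_eq` (`A^{lin}_b = ±(A_{∂p(b)} − Σ_{other letters}±A^{lin}_s)`).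
* §4 **`Peeling.norm_log_sub_lin_le`** — THE ESTIMATE (the inverse function theorem of (5.24) done by hand): `u ≡ ε` on `T` and
  `|g_{∂p(i)}| ≦ S` on the attached plaquettes with `a_n S ≦ ρ` ⇒ every `b ∈ Λ` of rank `< n` has `|u_b| ≦ a_n S` and
  `‖log u_b − Σ_i N_{bi} log g_{∂p(i)}‖ ≦ e_n(1+32Kρ)·S²` (`a_{n+1} = 3a_n + 1`, `e_{n+1} = κa_{n+1}² + 3e_n`; induction on the rank —
  NO a-priori smallness of the bond variables is assumed, it is derived).
* §5 THE CARRIER **`Peeling.linearisation L hF : AxialGaugeLinearisation 𝔤`** of a peeling with finitely many non-tree bonds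
  (`hF : (Λ ∖ T).Finite`): `I = B =` the non-tree bonds (print's «A_{∂p_i}, i ∈ J, a linearly independent set» = the attached
  plaquettes, one per non-tree bond), `Cfg = Peeling.SmallCfg` (tree gauge, `|u_b| ≦ ρ/4` off the tree — «in the small field
  region»), `A_{∂p_i} = log g_{∂p(i)}`, `A_{b_α} = log u_α`, `M_{iα} = inc(∂p(i), α)` (signed incidence), `N =` §3; and the three
  printed relations: **`Peeling.eq522`** (`‖A_{∂p_i} − Σ_α M_{iα}A_{b_α}‖ ≦ (4+128Kρ)Σ_α|A_{b_α}|²` on the small-field region —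
  «the first term in a power series convergent for small fields»), **`Peeling.sum_M_mul_N`** / **`Peeling.sum_N_mul_M`**
  (`MN = 1 = NM`: (5.23) inverts (5.22); the second from the first since the matrices are square), and
  **`Peeling.eq524Le : (π.linearisation L hF).Eq524Le`** — (5.24) with `ρ′ = ρ/(a_{R+1}(|B|+1))` and `c = e_{R+1}(1+32Kρ)|B|`,
  `R` the maximal rank («depending on N»); `eq524Le_SU2`, `eq524Le_UN` ([F3]'s own `SU(2)` and Bałaban's `U(N)`, every `N`).
* §6 (v1.1) **`Peeling.norm_log_sub_lin_le_of_weight`** — the WEIGHTED form of §4 (the Lie-algebra twin of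
  `PeelingEstimate`'s `Peeling.dist_le_of_weight`): weights `W, E` with `S + Σ_{other sides} W ≦ W(b) ≦ ρ` and
  `κW(b)² + Σ_{other sides} E ≦ E(b)` give `|u_b| ≦ W(b)`, `‖log u_b − A_b^{lin}‖ ≦ E(b)`; and for the COMB (Bałaban axial gauge of a
  box) `comb_others_sum` + **`norm_log_sub_lin_le_combGauge`**: `|u_b| ≦ height(b)·S` ([Balaban1985Averaging] (45)–(46) again) and
  `‖log u_b − Σ_i N_{bi} log g_{∂p(i)}‖ ≦ (1+32Kρ)·height(b)³·S²` whenever `(Σ_ν(hi_ν − lo_ν))·S ≦ ρ` — POLYNOMIAL constants in the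
  comb gauge (as in p32's instances, `c = 3m²`), versus the generic `3^{rank}` of §4.
Hence (5.24) holds in every gauge this thread has shown peelable — the comb = Bałaban axial gauge of a box (p32's instances,
re-derived for every `d` and `G`), staircases, the punctured block, the radial gauge, the nice block sublattices of steps 1)–3)
(`NiceSublatticePeeling`): step 5)'s «In this gauge we deduce an inequality like (5.24)» — the instances are spelled out in the
companion file `PeelingLinearisationInstances`.

HONEST SCOPE.  (a) Print derives (5.24) from «the inverse function theorem» without constants; here the constants are explicit but
crude (`a_n ~ 3ⁿ`, `n` = maximal rank + 1): they depend on the lattice portion only, as print allows («Some of the constants will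
depend on N»), and no polynomial dependence is claimed.  (b) The configurations are the small-field region OF THE GAUGE-FIXED BOND
VARIABLES (`|u_b| ≦ ρ/4`), as in p32's instances; print's «s.f. plaquettes» enter through the hypothesis `|A_{∂p_i}| < ρ′` of
`Eq524Le`.  (c) The plaquette index set is the set of ATTACHED plaquettes of the peeling (one per non-tree bond, print's linearly
independent `J`); other plaquettes of `P` are not variables of the carrier.  (d) `G` ranges over groups with §1's chart data
(`LocalLog`: [F3]'s standing assumptions); compactness is not used.  Definitions with bodies: `lsgn`, `otherLetters`,
`Peeling.loop/others/letter`, `Peeling.Nst/N/lin`, `aC/eC`, `inc`, `Peeling.SmallCfg`, `Peeling.linearisation`; everything else is a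
theorem; no new named facts, no `sorry`, axioms standard.  Unit `lit-balaban-p26` (literature-prover-lit-balaban-p26-g15-0).

Versions: v1 p327205 (§1–§5); v1.1 (this text) = v1 unchanged + §6.
-/

namespace Literature.MathematicalPhysics.QuantumFieldTheory.Federbush1986

noncomputable section

namespace PeelingObservation

open scoped BigOperators
open LatticeContour SimplyConnectedBox CombGaugeObservation

variable {d : ℕ}

/-! ## §1 Signs and the other three letters of a plaquette boundary -/

/-- The sign `±1` with which an oriented bond enters a contour word (`+` forwards, `−` backwards): the abelian letter of
paper I, `A_Γ = Σ ±A(e_α)`. [cite: Federbush1987PhaseCellIII, (5.11) p. 300; (5.22) p. 302] -/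
def lsgn (l : Letter d) : ℝ := if l.2 then 1 else -1

/-- [cite: Federbush1987PhaseCellIII, (5.11) p. 300] -/
@[simp] theorem lsgn_true (b : Bond d) : lsgn (b, true) = 1 := rfl

/-- [cite: Federbush1987PhaseCellIII, (5.11) p. 300] -/
@[simp] theorem lsgn_false (b : Bond d) : lsgn (b, false) = -1 := rfl

/-- `(±1)² = 1`. [cite: Federbush1987PhaseCellIII, (5.11) p. 300] -/
theorem lsgn_mul_self (l : Letter d) : lsgn l * lsgn l = 1 := by
  rcases l with ⟨b, _ | _⟩ <;> simp

/-- The signed letter of an abelian word sum is `lsgn l • a`. [cite: Federbush1986PhaseCellI, (1.1)–(1.2) p. 322] -/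
theorem ite_eq_lsgn_smul {V : Type*} [AddCommGroup V] [Module ℝ V] (l : Letter d) (a : V) :
    (if l.2 then a else -a) = lsgn l • a := by
  rcases l with ⟨b, _ | _⟩ <;> simp

/-- The letters of `∂p = (z; μ, ν)` other than those on the bond `b` (three of them when `b` is a side of a genuine square):
the oriented form of `PeelingEstimate`'s `otherSides`. [cite: Federbush1987PhaseCellIII, (5.9)–(5.10) Fig. 6 p. 300] -/
def otherLetters (z : LatticeContour.Site d) (μ ν : Fin d) (b : Bond d) : List (Letter d) :=
  (plaqLoop z μ ν).filter (fun l => l.1 ≠ b)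

/-- Membership in `otherLetters`. [cite: Federbush1987PhaseCellIII, (5.9)–(5.10) p. 300] -/
theorem mem_otherLetters_iff {z : LatticeContour.Site d} {μ ν : Fin d} {b : Bond d} {l : Letter d} :
    l ∈ otherLetters z μ ν b ↔ l ∈ plaqLoop z μ ν ∧ l.1 ≠ b := by
  simp only [otherLetters, List.mem_filter, decide_eq_true_eq]

/-- `otherSides` = the bonds of `otherLetters`. [cite: Federbush1987PhaseCellIII, (5.9)–(5.10) p. 300] -/
theorem otherSides_eq_map (z : LatticeContour.Site d) (μ ν : Fin d) (b : Bond d) :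
    otherSides z μ ν b = (otherLetters z μ ν b).map Prod.fst := by
  rw [otherSides, otherLetters, List.filter_map]; rfl

section Sides

variable (z : LatticeContour.Site d) {μ ν : Fin d} (hμν : μ ≠ ν)
include hμν

/-- The other letters of the first side `⟨z, z + e_μ⟩` (entering `∂p` forwards). [cite: Federbush1987PhaseCellIII, (5.9)–(5.10) p. 300] -/
theorem otherLetters_first :
    otherLetters z μ ν (z, μ) = [((z + ev μ, ν), true), ((z + ev ν, μ), false), ((z, ν), false)] := by
  have h1 : ((z + ev μ, ν) : Bond d) ≠ (z, μ) := fun h => hμν.symm (congrArg Prod.snd h)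
  have h2 : ((z + ev ν, μ) : Bond d) ≠ (z, μ) := fun h => add_ev_ne z ν (congrArg Prod.fst h)
  have h3 : ((z, ν) : Bond d) ≠ (z, μ) := fun h => hμν.symm (congrArg Prod.snd h)
  simp only [otherLetters, plaqLoop]
  rw [List.filter_cons_of_neg (by simp), List.filter_cons_of_pos (by exact decide_eq_true h1),
    List.filter_cons_of_pos (by exact decide_eq_true h2), List.filter_cons_of_pos (by exact decide_eq_true h3), List.filter_nil]

/-- The other letters of the second side `⟨z + e_μ, z + e_μ + e_ν⟩` (forwards). [cite: Federbush1987PhaseCellIII, (5.9)–(5.10) p. 300] -/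
theorem otherLetters_second :
    otherLetters z μ ν (z + ev μ, ν) = [((z, μ), true), ((z + ev ν, μ), false), ((z, ν), false)] := by
  have h1 : ((z, μ) : Bond d) ≠ (z + ev μ, ν) := fun h => hμν (congrArg Prod.snd h)
  have h2 : ((z + ev ν, μ) : Bond d) ≠ (z + ev μ, ν) := fun h => hμν (congrArg Prod.snd h)
  have h3 : ((z, ν) : Bond d) ≠ (z + ev μ, ν) := fun h => (add_ev_ne z μ) (congrArg Prod.fst h).symm
  simp only [otherLetters, plaqLoop]
  rw [List.filter_cons_of_pos (by exact decide_eq_true h1), List.filter_cons_of_neg (by simp),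
    List.filter_cons_of_pos (by exact decide_eq_true h2), List.filter_cons_of_pos (by exact decide_eq_true h3), List.filter_nil]

/-- The other letters of the third side `⟨z + e_ν, z + e_μ + e_ν⟩` (backwards). [cite: Federbush1987PhaseCellIII, (5.9)–(5.10) p. 300] -/
theorem otherLetters_third :
    otherLetters z μ ν (z + ev ν, μ) = [((z, μ), true), ((z + ev μ, ν), true), ((z, ν), false)] := by
  have h1 : ((z, μ) : Bond d) ≠ (z + ev ν, μ) := fun h => (add_ev_ne z ν) (congrArg Prod.fst h).symm
  have h2 : ((z + ev μ, ν) : Bond d) ≠ (z + ev ν, μ) := fun h => hμν.symm (congrArg Prod.snd h)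
  have h3 : ((z, ν) : Bond d) ≠ (z + ev ν, μ) := fun h => hμν.symm (congrArg Prod.snd h)
  simp only [otherLetters, plaqLoop]
  rw [List.filter_cons_of_pos (by exact decide_eq_true h1), List.filter_cons_of_pos (by exact decide_eq_true h2),
    List.filter_cons_of_neg (by simp), List.filter_cons_of_pos (by exact decide_eq_true h3), List.filter_nil]

/-- The other letters of the fourth side `⟨z, z + e_ν⟩` (backwards). [cite: Federbush1987PhaseCellIII, (5.9)–(5.10) p. 300] -/
theorem otherLetters_fourth :
    otherLetters z μ ν (z, ν) = [((z, μ), true), ((z + ev μ, ν), true), ((z + ev ν, μ), false)] := by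
  have h1 : ((z, μ) : Bond d) ≠ (z, ν) := fun h => hμν (congrArg Prod.snd h)
  have h2 : ((z + ev μ, ν) : Bond d) ≠ (z, ν) := fun h => add_ev_ne z μ (congrArg Prod.fst h)
  have h3 : ((z + ev ν, μ) : Bond d) ≠ (z, ν) := fun h => hμν (congrArg Prod.snd h)
  simp only [otherLetters, plaqLoop]
  rw [List.filter_cons_of_pos (by exact decide_eq_true h1), List.filter_cons_of_pos (by exact decide_eq_true h2),
    List.filter_cons_of_pos (by exact decide_eq_true h3), List.filter_cons_of_neg (by simp), List.filter_nil]

/-- In a genuine square each side carries exactly one letter of `∂p`: the abelian sum over `∂p` splits as the letter of `b` plus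
the other three letters. [cite: Federbush1987PhaseCellIII, (2.1) p. 296; (5.9)–(5.10) p. 300] -/
theorem wordSum_eq_lsgn_smul_add {V : Type*} [AddCommGroup V] [Module ℝ V] (a : Bond d → V) {l : Letter d}
    (hl : l ∈ plaqLoop z μ ν) :
    wordSum a (plaqLoop z μ ν) = lsgn l • a l.1 + wordSum a (otherLetters z μ ν l.1) := by
  rw [wordSum_plaqLoop]
  simp only [plaqLoop, List.mem_cons, List.mem_nil_iff, or_false] at hl
  rcases hl with rfl | rfl | rfl | rfl
  · rw [otherLetters_first z hμν]; simp [wordSum_eq_sum]; abel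
  · rw [otherLetters_second z hμν]; simp [wordSum_eq_sum]; abel
  · rw [otherLetters_third z hμν]; simp [wordSum_eq_sum]; abel
  · rw [otherLetters_fourth z hμν]; simp [wordSum_eq_sum]; abel

end Sides

/-! ## §2 One plaquette at the Lie-algebra level: the fourth side to first order in the plaquette variable and the other three
sides (one Baker–Campbell–Hausdorff step per letter) -/

section OnePlaquette

variable {G : Type*} [Group G] [MetricSpace G] [IsIsometricSMul G G] [IsIsometricSMul Gᵐᵒᵖ G]
variable {𝔤 : Type*} [NormedAddCommGroup 𝔤] [NormedSpace ℝ 𝔤] (L : LocalLog G 𝔤)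

/-- Four factors: `|log(g₁g₂g₃g₄) − (log g₁ + log g₂ + log g₃ + log g₄)| ≦ t² + 32Kt³` when `|g₁| + |g₂| + |g₃| + |g₄| ≦ t ≦ ρ`,
with `|g₁g₂g₃g₄| ≦ t` (`LocalLog.norm_log_wordHol_sub_wordSum_le` on the four-letter word). [cite: Federbush1987PhaseCellIII,
(1.7)–(1.8) p. 295; Lemma 5.1 (5.2) p. 299] -/
theorem norm_log_mul₄_sub_le (g₁ g₂ g₃ g₄ : G) (t : ℝ)
    (ht : dist 1 g₁ + dist 1 g₂ + dist 1 g₃ + dist 1 g₄ ≤ t) (htρ : t ≤ L.ρ) :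
    dist 1 (g₁ * g₂ * g₃ * g₄) ≤ t ∧
      ‖L.log (g₁ * g₂ * g₃ * g₄) - (L.log g₁ + L.log g₂ + L.log g₃ + L.log g₄)‖ ≤ t ^ 2 + 32 * L.K * t ^ 3 := by
  have h := L.norm_log_wordHol_sub_wordSum_le (fun g : G => g) [(g₁, true), (g₂, true), (g₃, true), (g₄, true)] t
    (by simpa [add_assoc] using ht) htρ
  have hw : wordHol (fun g : G => g) [(g₁, true), (g₂, true), (g₃, true), (g₄, true)] = g₁ * g₂ * g₃ * g₄ := by
    simp [wordHol, mul_assoc]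
  have hs : wordSum (fun g : G => L.log g) [(g₁, true), (g₂, true), (g₃, true), (g₄, true)] =
      L.log g₁ + L.log g₂ + L.log g₃ + L.log g₄ := by
    simp [wordSum, add_assoc]
  rw [hw, hs] at h
  refine ⟨h.1, h.2.trans (le_of_eq ?_)⟩
  simp only [List.length_cons, List.length_nil]
  push_cast
  ring

/-- **One plaquette, three known sides, at the Lie-algebra level.**  Let `p = (z; μ, ν)` be a genuine square, `l` one of the four
letters of `∂p` (on the bond `b = l.1`, sign `±`), `g_{∂p} = u₁u₂u₃⁻¹u₄⁻¹` the plaquette variable of `u`, and suppose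
`|g_{∂p}| + Σ_{other three sides s} |u_s| ≦ t ≦ ρ`.  Then `|u_b| ≦ t` and
`‖log u_b ∓ (log g_{∂p} − Σ_{other letters} ±log u_s)‖ ≦ t² + 32Kt³`: the relation `g_{∂p} = u₁u₂u₃⁻¹u₄⁻¹` solved for the
letter `b` (a four-letter word in `g_{∂p}^{±1}` and the other sides) and read to first order through the chart — the mechanism of
«A_{∂p_i} = Σ_α M_{iα}A_{b_α} (5.22) … the first term in a power series convergent for small fields … A_{b_α} = Σ N_{αi}A_{∂p_i}
(5.23)». [cite: Federbush1987PhaseCellIII, (5.22)–(5.23) p. 302; (1.7)–(1.8) p. 295; (5.11) p. 300] -/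
theorem norm_log_side_sub_le (u : Bond d → G) {z : LatticeContour.Site d} {μ ν : Fin d} (hμν : μ ≠ ν) {l : Letter d}
    (hl : l ∈ plaqLoop z μ ν) (t : ℝ)
    (ht : dist 1 (wordHol u (plaqLoop z μ ν)) + ((otherLetters z μ ν l.1).map fun s => dist (1 : G) (u s.1)).sum ≤ t)
    (htρ : t ≤ L.ρ) :
    dist 1 (u l.1) ≤ t ∧
      ‖L.log (u l.1) - lsgn l • (L.log (wordHol u (plaqLoop z μ ν)) -
        wordSum (fun s => L.log (u s)) (otherLetters z μ ν l.1))‖ ≤ t ^ 2 + 32 * L.K * t ^ 3 := by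
  -- the four letters of `g_{∂p}`
  set A := u (z, μ) with hA
  set B := u (z + ev μ, ν) with hB
  set C := u (z + ev ν, μ) with hC
  set D := u (z, ν) with hD
  set H := wordHol u (plaqLoop z μ ν) with hH
  have hHe : H = A * B * C⁻¹ * D⁻¹ := by rw [hH, wordHol_plaqLoop]
  have hρA : ∀ g : G, dist 1 g ≤ t → dist 1 g ≤ L.ρ := fun g hg => hg.trans htρ
  simp only [plaqLoop, List.mem_cons, List.mem_nil_iff, or_false] at hl
  rcases hl with rfl | rfl | rfl | rfl
  · -- first side: `A = H·D·C·B⁻¹`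
    rw [otherLetters_first z hμν] at ht ⊢
    simp only [List.map_cons, List.map_nil, List.sum_cons, List.sum_nil, add_zero] at ht
    have e : A = H * D * C * B⁻¹ := by rw [hHe]; group
    have ht' : dist 1 H + dist 1 D + dist 1 C + dist 1 B⁻¹ ≤ t := by
      rw [LocalLog.dist_one_inv]; rw [← hB, ← hC, ← hD] at ht; linarith
    obtain ⟨h1, h2⟩ := norm_log_mul₄_sub_le L H D C B⁻¹ t ht' htρ
    have hBρ : dist 1 B ≤ L.ρ := hρA B (by
      rw [← hB, ← hC, ← hD] at ht
      linarith [dist_nonneg (x := (1 : G)) (y := H), dist_nonneg (x := (1 : G)) (y := C), dist_nonneg (x := (1 : G)) (y := D)])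
    rw [L.log_inv B hBρ] at h2
    have hu : u (z, μ) = H * D * C * B⁻¹ := e
    refine ⟨by show dist 1 (u (z, μ)) ≤ t; rw [hu]; exact h1, ?_⟩
    simp only [lsgn_true, one_smul, wordSum, Bool.false_eq_true, ↓reduceIte, add_zero]
    rw [hu, ← hB, ← hC, ← hD]
    convert h2 using 2
    abel
  · -- second side: `B = A⁻¹·H·D·C`
    rw [otherLetters_second z hμν] at ht ⊢
    simp only [List.map_cons, List.map_nil, List.sum_cons, List.sum_nil, add_zero] at ht
    have e : B = A⁻¹ * H * D * C := by rw [hHe]; group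
    have ht' : dist 1 A⁻¹ + dist 1 H + dist 1 D + dist 1 C ≤ t := by
      rw [LocalLog.dist_one_inv]; rw [← hA, ← hC, ← hD] at ht; linarith
    obtain ⟨h1, h2⟩ := norm_log_mul₄_sub_le L A⁻¹ H D C t ht' htρ
    have hAρ : dist 1 A ≤ L.ρ := hρA A (by
      rw [← hA, ← hC, ← hD] at ht
      linarith [dist_nonneg (x := (1 : G)) (y := H), dist_nonneg (x := (1 : G)) (y := C), dist_nonneg (x := (1 : G)) (y := D)])
    rw [L.log_inv A hAρ] at h2
    have hu : u (z + ev μ, ν) = A⁻¹ * H * D * C := e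
    refine ⟨by show dist 1 (u (z + ev μ, ν)) ≤ t; rw [hu]; exact h1, ?_⟩
    simp only [lsgn_true, one_smul, wordSum, Bool.false_eq_true, ↓reduceIte, add_zero]
    rw [hu, ← hA, ← hC, ← hD]
    convert h2 using 2
    abel
  · -- third side: `C = D⁻¹·H⁻¹·A·B`
    rw [otherLetters_third z hμν] at ht ⊢
    simp only [List.map_cons, List.map_nil, List.sum_cons, List.sum_nil, add_zero] at ht
    have e : C = D⁻¹ * H⁻¹ * A * B := by rw [hHe]; group
    have ht' : dist 1 D⁻¹ + dist 1 H⁻¹ + dist 1 A + dist 1 B ≤ t := by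
      rw [LocalLog.dist_one_inv, LocalLog.dist_one_inv]; rw [← hA, ← hB, ← hD] at ht; linarith
    obtain ⟨h1, h2⟩ := norm_log_mul₄_sub_le L D⁻¹ H⁻¹ A B t ht' htρ
    have hDρ : dist 1 D ≤ L.ρ := hρA D (by
      rw [← hA, ← hB, ← hD] at ht
      linarith [dist_nonneg (x := (1 : G)) (y := H), dist_nonneg (x := (1 : G)) (y := A), dist_nonneg (x := (1 : G)) (y := B)])
    have hHρ : dist 1 H ≤ L.ρ := hρA H (by
      rw [← hA, ← hB, ← hD] at ht
      linarith [dist_nonneg (x := (1 : G)) (y := D), dist_nonneg (x := (1 : G)) (y := A), dist_nonneg (x := (1 : G)) (y := B)])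
    rw [L.log_inv D hDρ, L.log_inv H hHρ] at h2
    have hu : u (z + ev ν, μ) = D⁻¹ * H⁻¹ * A * B := e
    refine ⟨by show dist 1 (u (z + ev ν, μ)) ≤ t; rw [hu]; exact h1, ?_⟩
    simp only [lsgn_false, neg_smul, one_smul, wordSum, Bool.false_eq_true, ↓reduceIte, add_zero]
    rw [hu, ← hA, ← hB, ← hD]
    convert h2 using 2
    abel
  · -- fourth side: `D = H⁻¹·A·B·C⁻¹`
    rw [otherLetters_fourth z hμν] at ht ⊢
    simp only [List.map_cons, List.map_nil, List.sum_cons, List.sum_nil, add_zero] at ht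
    have e : D = H⁻¹ * A * B * C⁻¹ := by rw [hHe]; group
    have ht' : dist 1 H⁻¹ + dist 1 A + dist 1 B + dist 1 C⁻¹ ≤ t := by
      rw [LocalLog.dist_one_inv, LocalLog.dist_one_inv]; rw [← hA, ← hB, ← hC] at ht; linarith
    obtain ⟨h1, h2⟩ := norm_log_mul₄_sub_le L H⁻¹ A B C⁻¹ t ht' htρ
    have hCρ : dist 1 C ≤ L.ρ := hρA C (by
      rw [← hA, ← hB, ← hC] at ht
      linarith [dist_nonneg (x := (1 : G)) (y := H), dist_nonneg (x := (1 : G)) (y := A), dist_nonneg (x := (1 : G)) (y := B)])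
    have hHρ : dist 1 H ≤ L.ρ := hρA H (by
      rw [← hA, ← hB, ← hC] at ht
      linarith [dist_nonneg (x := (1 : G)) (y := C), dist_nonneg (x := (1 : G)) (y := A), dist_nonneg (x := (1 : G)) (y := B)])
    rw [L.log_inv C hCρ, L.log_inv H hHρ] at h2
    have hu : u (z, ν) = H⁻¹ * A * B * C⁻¹ := e
    refine ⟨by show dist 1 (u (z, ν)) ≤ t; rw [hu]; exact h1, ?_⟩
    simp only [lsgn_false, neg_smul, one_smul, wordSum, Bool.false_eq_true, ↓reduceIte, add_zero]
    rw [hu, ← hA, ← hB, ← hC]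
    convert h2 using 2
    abel

end OnePlaquette

/-! ## §3 The abelian solution of a peeling: the matrix `N_{αi}` of (5.23) -/

section Linear

variable {P : Set (LatticeContour.Plaq d)} {Λ T : Set (Bond d)} (π : Peeling P Λ T)

/-- The boundary word `∂p(b)` of the plaquette attached to `b`. [cite: Federbush1987PhaseCellIII, §5.3 3) p. 303; (5.9)–(5.10) p. 300] -/
abbrev Peeling.loop (b : Bond d) : List (Letter d) := plaqLoop (π.plaq b).1 (π.plaq b).2.1 (π.plaq b).2.2

/-- The three letters of `∂p(b)` not on `b`. [cite: Federbush1987PhaseCellIII, §5.3 3) p. 303; (5.9)–(5.10) p. 300] -/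
abbrev Peeling.others (b : Bond d) : List (Letter d) := otherLetters (π.plaq b).1 (π.plaq b).2.1 (π.plaq b).2.2 b

/-- The letter of `∂p(b)` on the bond `b` (forwards on the first two sides, backwards on the last two).
[cite: Federbush1987PhaseCellIII, (5.9)–(5.11) p. 300] -/
def Peeling.letter (b : Bond d) : Letter d :=
  (b, decide (b = ((π.plaq b).1, (π.plaq b).2.1) ∨ b = ((π.plaq b).1 + ev (π.plaq b).2.1, (π.plaq b).2.2)))

/-- [cite: Federbush1987PhaseCellIII, (5.9)–(5.11) p. 300] -/
@[simp] theorem Peeling.letter_fst (b : Bond d) : (π.letter b).1 = b := rfl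

/-- For a non-tree bond, its letter is a letter of the attached plaquette's boundary. [cite: Federbush1987PhaseCellIII, §5.3 3)
p. 303; (5.9)–(5.11) p. 300] -/
theorem Peeling.letter_mem {b : Bond d} (hb : b ∈ Λ) (hbT : b ∉ T) : π.letter b ∈ π.loop b := by
  obtain ⟨l, hl, hlb⟩ := π.mem_plaq b hb hbT
  have hμν := π.plaq_ne b hb hbT
  suffices h : π.letter b = l by rw [h]; exact hl
  unfold Peeling.letter
  generalize (π.plaq b).1 = z at hl ⊢
  generalize (π.plaq b).2.1 = μ at hl hμν ⊢
  generalize (π.plaq b).2.2 = ν at hl hμν ⊢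
  have h3 : ¬ (((z + ev ν, μ) : Bond d) = (z, μ) ∨ ((z + ev ν, μ) : Bond d) = (z + ev μ, ν)) := by
    rintro (h | h)
    · exact add_ev_ne z ν (congrArg Prod.fst h)
    · exact hμν (congrArg Prod.snd h)
  have h4 : ¬ (((z, ν) : Bond d) = (z, μ) ∨ ((z, ν) : Bond d) = (z + ev μ, ν)) := by
    rintro (h | h)
    · exact hμν (congrArg Prod.snd h).symm
    · exact (add_ev_ne z μ) (congrArg Prod.fst h).symm
  simp only [plaqLoop, List.mem_cons, List.mem_nil_iff, or_false] at hl
  rcases hl with rfl | rfl | rfl | rfl <;> simp only at hlb <;> subst hlb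
  · simp
  · simp
  · simp only [h3, decide_false]
  · simp only [h4, decide_false]

open scoped Classical in
/-- Stage `n` of the abelian elimination: the coefficient of the plaquette variable `A_{∂p(i)}` in the bond variable `A_b`,
correct for bonds of rank `< n` — solving `A_{∂p(b)} = ±A_b + Σ_{other sides} ±A_s` for `A_b` one plaquette at a time, `A ≡ 0`
on the tree («A_{b_α} = Σ_{i∈J} N_{αi}A_{∂p_i} (5.23) (for bonds b_α not assigned ε by the gauge)»).
[cite: Federbush1987PhaseCellIII, (5.22)–(5.23) p. 302; §5.3 2)–3) p. 303] -/
def Peeling.Nst : ℕ → Bond d → Bond d → ℝ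
  | 0, _, _ => 0
  | n + 1, b, i => if b ∈ Λ ∧ b ∉ T then
      lsgn (π.letter b) * ((if i = b then 1 else 0) - wordSum (fun s => Peeling.Nst n s i) (π.others b)) else 0

/-- Tree bonds (and bonds outside `Λ`) carry no plaquette variable at any stage. [cite: Federbush1987PhaseCellIII, (5.23) p. 302] -/
theorem Peeling.Nst_of_not (n : ℕ) {b : Bond d} (hb : ¬ (b ∈ Λ ∧ b ∉ T)) (i : Bond d) : π.Nst n b i = 0 := by
  cases n with
  | zero => rfl
  | succ n => simp only [Peeling.Nst]; rw [if_neg hb]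

/-- The stage-`n + 1` coefficient of a non-tree bond. [cite: Federbush1987PhaseCellIII, (5.23) p. 302] -/
theorem Peeling.Nst_succ_of_mem (n : ℕ) {b : Bond d} (hb : b ∈ Λ) (hbT : b ∉ T) (i : Bond d) :
    π.Nst (n + 1) b i =
      lsgn (π.letter b) * ((if i = b then 1 else 0) - wordSum (fun s => π.Nst n s i) (π.others b)) := by
  simp only [Peeling.Nst]; rw [if_pos ⟨hb, hbT⟩]

/-- The elimination stabilises: stage `n + 1` agrees with stage `n` on bonds of rank `< n`.
[cite: Federbush1987PhaseCellIII, (5.23) p. 302; §5.3 2)–3) p. 303] -/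
theorem Peeling.Nst_succ_eq : ∀ n : ℕ, ∀ b : Bond d, (b ∈ Λ → b ∉ T → π.rank b < n) →
    ∀ i, π.Nst (n + 1) b i = π.Nst n b i := by
  intro n
  induction n with
  | zero =>
    intro b hb i
    have hnot : ¬ (b ∈ Λ ∧ b ∉ T) := fun h => absurd (hb h.1 h.2) (Nat.not_lt_zero _)
    rw [π.Nst_of_not _ hnot, π.Nst_of_not _ hnot]
  | succ n ih =>
    intro b hb i
    by_cases hfree : b ∈ Λ ∧ b ∉ T
    · rw [π.Nst_succ_of_mem _ hfree.1 hfree.2, π.Nst_succ_of_mem _ hfree.1 hfree.2]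
      congr 2
      refine wordSum_congr _ fun l hl => ?_
      obtain ⟨hl, hne⟩ := mem_otherLetters_iff.1 hl
      rcases π.lower b hfree.1 hfree.2 l hl hne with hT | ⟨hΛ, hlt⟩
      · have hnot : ¬ (l.1 ∈ Λ ∧ l.1 ∉ T) := fun h => h.2 hT
        rw [π.Nst_of_not _ hnot, π.Nst_of_not _ hnot]
      · exact ih l.1 (fun _ _ => by have := hb hfree.1 hfree.2; omega) i
    · rw [π.Nst_of_not _ hfree, π.Nst_of_not _ hfree]

/-- … hence every later stage agrees with stage `n` there. [cite: Federbush1987PhaseCellIII, (5.23) p. 302] -/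
theorem Peeling.Nst_eq_of_le {n m : ℕ} (h : n ≤ m) (b : Bond d) (hb : b ∈ Λ → b ∉ T → π.rank b < n) (i : Bond d) :
    π.Nst m b i = π.Nst n b i := by
  induction m, h using Nat.le_induction with
  | base => rfl
  | succ m hnm ih => rw [π.Nst_succ_eq m b (fun h1 h2 => lt_of_lt_of_le (hb h1 h2) hnm) i, ih]

/-- **The matrix `N_{αi}` of (5.23) for a peeling**: the coefficient of `A_{∂p(i)}` in the abelian (first-order) bond variable
`A_α`, `α` a non-tree bond, read off at the stage where it has stabilised. [cite: Federbush1987PhaseCellIII, (5.23) p. 302] -/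
def Peeling.N (b i : Bond d) : ℝ := π.Nst (π.rank b + 1) b i

/-- `N_{αi} = 0` unless `α` is a non-tree bond of `Λ`. [cite: Federbush1987PhaseCellIII, (5.23) p. 302] -/
theorem Peeling.N_of_not {b : Bond d} (hb : ¬ (b ∈ Λ ∧ b ∉ T)) (i : Bond d) : π.N b i = 0 := π.Nst_of_not _ hb i

/-- **The elimination identity for `N`**: for a non-tree bond `b` with letter `±` in `∂p(b)`,
`N_{bi} = ±(δ_{ib} − Σ_{other letters s of ∂p(b)} ±N_{si})` — the abelian plaquette relation of `p(b)` solved for `b`.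
[cite: Federbush1987PhaseCellIII, (5.22)–(5.23) p. 302] -/
theorem Peeling.N_eq {b : Bond d} (hb : b ∈ Λ) (hbT : b ∉ T) (i : Bond d) :
    π.N b i = lsgn (π.letter b) * ((if i = b then 1 else 0) - wordSum (fun s => π.N s i) (π.others b)) := by
  unfold Peeling.N
  rw [π.Nst_succ_of_mem _ hb hbT]
  congr 2
  refine wordSum_congr _ fun l hl => ?_
  obtain ⟨hl, hne⟩ := mem_otherLetters_iff.1 hl
  rcases π.lower b hb hbT l hl hne with hT | ⟨hΛ, hlt⟩
  · have hnot : ¬ (l.1 ∈ Λ ∧ l.1 ∉ T) := fun h => h.2 hT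
    rw [π.Nst_of_not _ hnot, π.Nst_of_not _ hnot]
  · exact π.Nst_eq_of_le (Nat.succ_le_of_lt hlt) l.1 (fun _ _ => Nat.lt_succ_self _) i

/-- **The abelian plaquette relations hold for `N`** («(5.23) inverts (5.22)»): for non-tree bonds `b, j`,
`Σ_{letters s of ∂p(j)} ±N_{sb} = δ_{jb}` — the first-order bond variables `A_s = Σ_i N_{si}A_{∂p_i}` reproduce every attached
plaquette variable. [cite: Federbush1987PhaseCellIII, (5.22)–(5.23) p. 302] -/
theorem Peeling.wordSum_N_loop {j : Bond d} (hj : j ∈ Λ) (hjT : j ∉ T) (i : Bond d) :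
    wordSum (fun s => π.N s i) (π.loop j) = if i = j then 1 else 0 := by
  rw [wordSum_eq_lsgn_smul_add (π.plaq j).1 (π.plaq_ne j hj hjT) (fun s => π.N s i) (π.letter_mem hj hjT)]
  simp only [Peeling.letter_fst, smul_eq_mul]
  rw [π.N_eq hj hjT i, ← mul_assoc, lsgn_mul_self, one_mul, sub_add_cancel]

variable {V : Type*} [AddCommGroup V] [Module ℝ V]

/-- `Σ_i (Σ_{s∈Γ} ±c_{si}) • A_i = Σ_{s∈Γ} ±(Σ_i c_{si} • A_i)`. [cite: Federbush1986PhaseCellI, (1.1)–(1.2) p. 322] -/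
theorem sum_wordSum_smul (Fs : Finset (Bond d)) (c : Bond d → Bond d → ℝ) (A : Bond d → V) :
    ∀ W : List (Letter d), ∑ i ∈ Fs, wordSum (fun s => c s i) W • A i = wordSum (fun s => ∑ i ∈ Fs, c s i • A i) W
  | [] => by simp [wordSum]
  | l :: W => by
    rw [wordSum_cons', ← sum_wordSum_smul Fs c A W]
    simp_rw [wordSum_cons', add_smul, Finset.sum_add_distrib]
    rcases l with ⟨s, _ | _⟩ <;> simp [Finset.sum_neg_distrib, neg_smul]

/-- **The first-order bond variables (5.23)** of a family of plaquette variables `A_{∂p(i)}`, `i` ranging over the non-tree bonds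
`Fs`: `A_b^{lin} = Σ_{i} N_{bi} A_{∂p(i)}`. [cite: Federbush1987PhaseCellIII, (5.23) p. 302] -/
def Peeling.lin (Fs : Finset (Bond d)) (A : Bond d → V) (b : Bond d) : V := ∑ i ∈ Fs, π.N b i • A i

/-- `A^{lin} = 0` on the tree (and off `Λ`). [cite: Federbush1987PhaseCellIII, (5.23) p. 302] -/
theorem Peeling.lin_of_not (Fs : Finset (Bond d)) (A : Bond d → V) {b : Bond d} (hb : ¬ (b ∈ Λ ∧ b ∉ T)) :
    π.lin Fs A b = 0 := by
  unfold Peeling.lin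
  exact Finset.sum_eq_zero fun i _ => by rw [π.N_of_not hb, zero_smul]

/-- **The elimination identity for the first-order bond variables**: `A_b^{lin} = ±(A_{∂p(b)} − Σ_{other letters s} ±A_s^{lin})`
for a non-tree bond `b ∈ Fs`. [cite: Federbush1987PhaseCellIII, (5.22)–(5.23) p. 302] -/
theorem Peeling.lin_eq (Fs : Finset (Bond d)) (A : Bond d → V) {b : Bond d} (hb : b ∈ Λ) (hbT : b ∉ T) (hbF : b ∈ Fs) :
    π.lin Fs A b = lsgn (π.letter b) • (A b - wordSum (π.lin Fs A) (π.others b)) := by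
  unfold Peeling.lin
  have h1 : ∀ i ∈ Fs, π.N b i • A i =
      lsgn (π.letter b) • ((if i = b then A i else 0) - wordSum (fun s => π.N s i) (π.others b) • A i) := by
    intro i _
    rw [π.N_eq hb hbT i, mul_smul, sub_smul, ite_smul, one_smul, zero_smul]
  rw [Finset.sum_congr rfl h1, ← Finset.smul_sum, Finset.sum_sub_distrib, Finset.sum_ite_eq' Fs b, if_pos hbF,
    sum_wordSum_smul Fs π.N A]

end Linear

/-! ## §4 The estimate: bond variables to first order in the attached plaquette variables, with a quadratic remainder -/

/-- The size constants `a_n` (`a_0 = 0`, `a_{n+1} = 3a_n + 1`, i.e. `(3ⁿ − 1)/2`): `|u_b| ≦ a_{rank(b)+1}·S`.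
[cite: Federbush1987PhaseCellIII, §5.3 p. 303 «A number of constants arise …»] -/
def aC : ℕ → ℝ
  | 0 => 0
  | n + 1 => 3 * aC n + 1

/-- The remainder constants `e_n(κ)` (`e_0 = 0`, `e_{n+1} = κa_{n+1}² + 3e_n`): `‖A_b − A_b^{lin}‖ ≦ e_{rank(b)+1}·S²`.
[cite: Federbush1987PhaseCellIII, §5.3 p. 303 «A number of constants arise …»] -/
def eC (κ : ℝ) : ℕ → ℝ
  | 0 => 0
  | n + 1 => κ * aC (n + 1) ^ 2 + 3 * eC κ n

/-- [cite: Federbush1987PhaseCellIII, §5.3 p. 303] -/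
@[simp] theorem aC_zero : aC 0 = 0 := rfl
/-- [cite: Federbush1987PhaseCellIII, §5.3 p. 303] -/
theorem aC_succ (n : ℕ) : aC (n + 1) = 3 * aC n + 1 := rfl
/-- [cite: Federbush1987PhaseCellIII, §5.3 p. 303] -/
@[simp] theorem eC_zero (κ : ℝ) : eC κ 0 = 0 := rfl
/-- [cite: Federbush1987PhaseCellIII, §5.3 p. 303] -/
theorem eC_succ (κ : ℝ) (n : ℕ) : eC κ (n + 1) = κ * aC (n + 1) ^ 2 + 3 * eC κ n := rfl

/-- [cite: Federbush1987PhaseCellIII, §5.3 p. 303] -/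
theorem aC_nonneg : ∀ n, 0 ≤ aC n
  | 0 => le_rfl
  | n + 1 => by rw [aC_succ]; linarith [aC_nonneg n]

/-- [cite: Federbush1987PhaseCellIII, §5.3 p. 303] -/
theorem aC_le_succ (n : ℕ) : aC n ≤ aC (n + 1) := by rw [aC_succ]; linarith [aC_nonneg n]

/-- [cite: Federbush1987PhaseCellIII, §5.3 p. 303] -/
theorem one_le_aC_succ (n : ℕ) : 1 ≤ aC (n + 1) := by rw [aC_succ]; linarith [aC_nonneg n]

/-- [cite: Federbush1987PhaseCellIII, §5.3 p. 303] -/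
theorem eC_nonneg {κ : ℝ} (hκ : 0 ≤ κ) : ∀ n, 0 ≤ eC κ n
  | 0 => le_rfl
  | n + 1 => by rw [eC_succ]; have := eC_nonneg hκ n; positivity

/-- `‖Σ_{s∈Γ} ±a_s‖ ≦ Σ_{s∈Γ} ‖a_s‖`. [cite: Federbush1987PhaseCellIII, Lemma 5.1 (5.2) p. 299] -/
theorem norm_wordSum_le_sum {W : Type*} [NormedAddCommGroup W] (a : Bond d → W) :
    ∀ Γ : List (Letter d), ‖wordSum a Γ‖ ≤ (Γ.map fun l => ‖a l.1‖).sum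
  | [] => by simp [wordSum]
  | l :: Γ => by
    rw [wordSum_cons', List.map_cons, List.sum_cons]
    refine (norm_add_le _ _).trans (add_le_add (le_of_eq ?_) (norm_wordSum_le_sum a Γ))
    split_ifs
    · rfl
    · exact norm_neg _

/-- `|±1| = 1`. [cite: Federbush1987PhaseCellIII, (5.11) p. 300] -/
theorem abs_lsgn (l : Letter d) : |lsgn l| = 1 := by
  rcases l with ⟨b, _ | _⟩ <;> simp

/-- `otherLetters` has three entries for a side of a genuine square. [cite: Federbush1987PhaseCellIII, (5.9)–(5.10) p. 300] -/
theorem length_otherLetters {z : LatticeContour.Site d} {μ ν : Fin d} (hμν : μ ≠ ν) {l : Letter d} (hl : l ∈ plaqLoop z μ ν) :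
    (otherLetters z μ ν l.1).length = 3 := by
  simp only [plaqLoop, List.mem_cons, List.mem_nil_iff, or_false] at hl
  rcases hl with rfl | rfl | rfl | rfl
  · rw [otherLetters_first z hμν]; rfl
  · rw [otherLetters_second z hμν]; rfl
  · rw [otherLetters_third z hμν]; rfl
  · rw [otherLetters_fourth z hμν]; rfl

section Estimate

variable {G : Type*} [Group G] [MetricSpace G] [IsIsometricSMul G G] [IsIsometricSMul Gᵐᵒᵖ G]
variable {𝔤 : Type*} [NormedAddCommGroup 𝔤] [NormedSpace ℝ 𝔤] (L : LocalLog G 𝔤)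
variable {P : Set (LatticeContour.Plaq d)} {Λ T : Set (Bond d)} (π : Peeling P Λ T)

/-- **THE PEELING LINEARISATION ESTIMATE** (the inverse function theorem of (5.24), by hand, one plaquette at a time).  Let `π` peel
`Λ` relative to `(T, P)`, `u ≡ ε` on `T`, and let every attached plaquette variable of a non-tree bond satisfy `|g_{∂p(i)}| ≦ S`
(`A_{∂p(i)} = log g_{∂p(i)}`; NO a-priori smallness of the bond variables).  If `a_n·S ≦ ρ` then every `b ∈ Λ` of
rank `< n` has `|u_b| ≦ a_n S` and `‖log u_b − Σ_i N_{bi}A_{∂p(i)}‖ ≦ e_n(κ)·S²`, `κ = 1 + 32Kρ` — induction on the rank: the sides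
of `p(b)` other than `b` are tree bonds or peeled earlier, `§2` reads the plaquette relation to first order (error `≦ κ(a_n S)²`),
`§3`'s elimination identity matches the linear parts (error `≦ 3e_{n−1}S²`).
[cite: Federbush1987PhaseCellIII, (5.22)–(5.24) p. 302; §5.3 2)–5) pp. 303–304] -/
theorem Peeling.norm_log_sub_lin_le (Fs : Finset (Bond d)) (hFs : ∀ b, b ∈ Fs ↔ b ∈ Λ ∧ b ∉ T)
    (u : Bond d → G) (hg : ∀ b ∈ T, u b = 1) {S : ℝ} (hS0 : 0 ≤ S)
    (hS : ∀ i ∈ Fs, dist 1 (wordHol u (π.loop i)) ≤ S) :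
    ∀ n : ℕ, aC n * S ≤ L.ρ → ∀ b ∈ Λ, π.rank b < n →
      dist 1 (u b) ≤ aC n * S ∧
        ‖L.log (u b) - π.lin Fs (fun i => L.log (wordHol u (π.loop i))) b‖ ≤ eC (1 + 32 * L.K * L.ρ) n * S ^ 2 := by
  set κ : ℝ := 1 + 32 * L.K * L.ρ with hκ
  have hK := L.K_nonneg
  have hρ0 := L.ρ_pos
  have hκ0 : 0 ≤ κ := by rw [hκ]; positivity
  set A : Bond d → 𝔤 := fun i => L.log (wordHol u (π.loop i)) with hA
  -- tree bonds: everything vanishes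
  have htree : ∀ n, ∀ b ∈ T, dist 1 (u b) ≤ aC n * S ∧ ‖L.log (u b) - π.lin Fs A b‖ ≤ eC κ n * S ^ 2 := by
    intro n b hbT
    rw [hg b hbT, dist_self, L.log_one, π.lin_of_not Fs A (fun h => h.2 hbT), sub_zero, norm_zero]
    exact ⟨mul_nonneg (aC_nonneg n) hS0, mul_nonneg (eC_nonneg hκ0 n) (sq_nonneg S)⟩
  intro n
  induction n with
  | zero => intro _ b _ h; exact absurd h (Nat.not_lt_zero _)
  | succ n ih =>
    intro hn b hb hbn
    by_cases hbT : b ∈ T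
    · exact htree _ b hbT
    have hn' : aC n * S ≤ L.ρ := (mul_le_mul_of_nonneg_right (aC_le_succ n) hS0).trans hn
    have ih' := ih hn'
    have hbF : b ∈ Fs := (hFs b).2 ⟨hb, hbT⟩
    have hμν := π.plaq_ne b hb hbT
    have hl := π.letter_mem hb hbT
    -- the other three sides: size `≦ a_n S`, linearisation error `≦ e_n S²`
    have hside : ∀ s ∈ π.others b, dist 1 (u s.1) ≤ aC n * S ∧ ‖L.log (u s.1) - π.lin Fs A s.1‖ ≤ eC κ n * S ^ 2 := by
      intro s hs
      obtain ⟨hs, hne⟩ := mem_otherLetters_iff.1 hs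
      rcases π.lower b hb hbT s hs hne with hT | ⟨hΛ, hlt⟩
      · exact htree n s.1 hT
      · exact ih' s.1 hΛ (by omega)
    have hlen : (π.others b).length = 3 := length_otherLetters hμν hl
    have hsum1 : ((π.others b).map fun s => dist (1 : G) (u s.1)).sum ≤ 3 * (aC n * S) := by
      have h := List.sum_le_card_nsmul ((π.others b).map fun s => dist (1 : G) (u s.1)) (aC n * S) (fun x hx => by
        obtain ⟨s, hs, rfl⟩ := List.mem_map.1 hx; exact (hside s hs).1)
      rwa [List.length_map, hlen, nsmul_eq_mul, Nat.cast_ofNat] at h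
    -- the total size of the word solving for `b`
    have ht : dist 1 (wordHol u (π.loop b)) + ((π.others b).map fun s => dist (1 : G) (u s.1)).sum ≤ aC (n + 1) * S := by
      rw [aC_succ]; have := hS b hbF; linarith
    obtain ⟨hdist, herr⟩ := norm_log_side_sub_le L u hμν hl (aC (n + 1) * S) ht hn
    rw [Peeling.letter_fst] at hdist herr
    refine ⟨hdist, ?_⟩
    -- the linear parts match by the elimination identity
    have hlin := π.lin_eq Fs A hb hbT hbF
    have hsplit : L.log (u b) - π.lin Fs A b =
        (L.log (u b) - lsgn (π.letter b) • (A b - wordSum (fun s => L.log (u s)) (π.others b))) +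
          lsgn (π.letter b) • wordSum (π.lin Fs A - fun s => L.log (u s)) (π.others b) := by
      rw [hlin, wordSum_sub_pointwise]; simp only [smul_sub]; abel
    rw [hsplit]
    have hsum2 : ((π.others b).map fun s => ‖(π.lin Fs A - fun s => L.log (u s)) s.1‖).sum ≤ 3 * (eC κ n * S ^ 2) := by
      have h := List.sum_le_card_nsmul ((π.others b).map fun s => ‖(π.lin Fs A - fun s => L.log (u s)) s.1‖)
        (eC κ n * S ^ 2) (fun x hx => by
          obtain ⟨s, hs, rfl⟩ := List.mem_map.1 hx
          rw [Pi.sub_apply, norm_sub_rev]; exact (hside s hs).2)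
      rwa [List.length_map, hlen, nsmul_eq_mul, Nat.cast_ofNat] at h
    have hterm2 : ‖lsgn (π.letter b) • wordSum (π.lin Fs A - fun s => L.log (u s)) (π.others b)‖ ≤ 3 * (eC κ n * S ^ 2) := by
      rw [norm_smul, Real.norm_eq_abs, abs_lsgn, one_mul]
      exact (norm_wordSum_le_sum _ _).trans hsum2
    have hterm1 : ‖L.log (u b) - lsgn (π.letter b) • (A b - wordSum (fun s => L.log (u s)) (π.others b))‖ ≤
        κ * (aC (n + 1) * S) ^ 2 := by
      refine herr.trans ?_
      have ht0 : 0 ≤ aC (n + 1) * S := mul_nonneg (aC_nonneg _) hS0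
      have h3 : (aC (n + 1) * S) ^ 3 ≤ L.ρ * (aC (n + 1) * S) ^ 2 := by
        rw [pow_succ, mul_comm]; exact mul_le_mul_of_nonneg_right hn (sq_nonneg _)
      rw [hκ]; nlinarith [mul_le_mul_of_nonneg_left h3 (by positivity : (0 : ℝ) ≤ 32 * L.K)]
    refine (norm_add_le _ _).trans ?_
    rw [eC_succ]
    nlinarith [hterm1, hterm2]

end Estimate

/-! ## §5 The carrier of (5.22)–(5.24) for a peeling and the three printed relations: (5.22) to first order, (5.23) inverts (5.22),
(5.24) -/

section Carrier

-- the carrier `AxialGaugeLinearisation` (r17) lives in `Type`: so do `G` and `𝔤` in this section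
variable {G : Type} [Group G] [MetricSpace G] [IsIsometricSMul G G] [IsIsometricSMul Gᵐᵒᵖ G]
variable {𝔤 : Type} [NormedAddCommGroup 𝔤] [NormedSpace ℝ 𝔤] (L : LocalLog G 𝔤)
variable {P : Set (LatticeContour.Plaq d)} {Λ T : Set (Bond d)} (π : Peeling P Λ T)

/-- The signed incidence number of the bond `b` in the contour word `Γ` (`+1` per forward letter on `b`, `−1` per backward one):
the matrix `M_{iα}` of (5.22) is `inc(∂p_i, b_α)`. [cite: Federbush1987PhaseCellIII, (5.22) p. 302] -/
def inc (Γ : List (Letter d)) (b : Bond d) : ℝ := wordSum (fun s => if s = b then (1 : ℝ) else 0) Γ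

/-- `Σ_{α∈Fs} inc(Γ, α) • x_α = Σ_{letters s of Γ on Fs} ±x_s`. [cite: Federbush1987PhaseCellIII, (5.22) p. 302] -/
theorem sum_inc_smul {V : Type*} [AddCommGroup V] [Module ℝ V] (Fs : Finset (Bond d)) (Γ : List (Letter d)) (x : Bond d → V) :
    ∑ α ∈ Fs, inc Γ α • x α = wordSum (fun s => if s ∈ Fs then x s else 0) Γ := by
  classical
  unfold inc
  rw [sum_wordSum_smul Fs (fun s α => if s = α then (1 : ℝ) else 0) x Γ]
  refine wordSum_congr _ fun l _ => ?_
  simp_rw [ite_smul, one_smul, zero_smul, Finset.sum_ite_eq]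

variable (G) in
/-- THE SMALL-FIELD CONFIGURATIONS IN THE TREE GAUGE: `u ≡ ε` on `T` («the bonds in a maximal tree are assigned the identity as a
choice of gauge») and `|u_b| ≦ ρ/4` on the non-tree bonds of `Λ` («in the small field region»: then every plaquette variable of `Λ`
is within `ρ` of `ε` and all logarithms are honest). [cite: Federbush1987PhaseCellIII, §5.2 p. 302; §5.3 2)–3) p. 303] -/
def Peeling.SmallCfg (_π : Peeling P Λ T) (ρ : ℝ) : Type :=
  {u : Bond d → G // (∀ b ∈ T, u b = 1) ∧ ∀ b ∈ Λ, b ∉ T → dist 1 (u b) ≤ ρ / 4}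

/-- **The (5.22)–(5.24) carrier of a peelable gauge** (r17's `AxialGaugeLinearisation`): plaquettes `I` = the attached plaquettes
`p(i)` of the non-tree bonds `i` («A_{∂p_i}, i ∈ J, a linearly independent set» — indexed by the non-tree bonds themselves), free bonds
`B` = the non-tree bonds of `Λ` («bonds b_α not assigned ε by the gauge»), configurations = the small-field region in the tree gauge,
`A_{∂p_i} = log g_{∂p(i)}`, `A_{b_α} = log u_α`, `M_{iα} = inc(∂p(i), α)` ((5.22)), `N_{αi}` = the abelian solution of the peeling
((5.23)); any group `G` with §1's chart data `L`. [cite: Federbush1987PhaseCellIII, (5.22)–(5.24) p. 302; §5.3 3)–5) pp. 303–304] -/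
def Peeling.linearisation (hF : (Λ \ T).Finite) : AxialGaugeLinearisation 𝔤 where
  I := ↥hF.toFinset
  B := ↥hF.toFinset
  Cfg := π.SmallCfg G L.ρ
  plaq u i := L.log (wordHol u.1 (π.loop i.1))
  bond u α := L.log (u.1 α.1)
  M i α := inc (π.loop i.1) α.1
  Nmat α i := π.N α.1 i.1

variable {L π}

/-- Membership in the index set of the carrier = being a non-tree bond of `Λ`. [cite: Federbush1987PhaseCellIII, (5.23) p. 302] -/
theorem mem_toFinset_iff (hF : (Λ \ T).Finite) {b : Bond d} : b ∈ hF.toFinset ↔ b ∈ Λ ∧ b ∉ T := by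
  rw [Set.Finite.mem_toFinset, Set.mem_sdiff]

/-- Every letter of an attached plaquette boundary lies on a tree bond or on a non-tree bond of `Λ`.
[cite: Federbush1987PhaseCellIII, §5.3 3) p. 303] -/
theorem Peeling.letter_cases (π : Peeling P Λ T) {i : Bond d} (hi : i ∈ Λ) (hiT : i ∉ T) {l : Letter d} (hl : l ∈ π.loop i) :
    l.1 ∈ T ∨ (l.1 ∈ Λ ∧ l.1 ∉ T) := by
  by_cases hne : l.1 = i
  · rw [hne]; exact Or.inr ⟨hi, hiT⟩
  · rcases π.lower i hi hiT l hl hne with h | ⟨h, -⟩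
    · exact Or.inl h
    · by_cases hT : l.1 ∈ T
      · exact Or.inl hT
      · exact Or.inr ⟨h, hT⟩

omit [IsIsometricSMul G G] [IsIsometricSMul Gᵐᵒᵖ G] in
/-- In the small-field region every letter of an attached plaquette boundary is within `ρ/4` of `ε`.
[cite: Federbush1987PhaseCellIII, §5.2 p. 302] -/
theorem Peeling.dist_letter_le (π : Peeling P Λ T) (u : π.SmallCfg G L.ρ) {i : Bond d} (hi : i ∈ Λ) (hiT : i ∉ T)
    {l : Letter d} (hl : l ∈ π.loop i) : dist 1 (u.1 l.1) ≤ L.ρ / 4 := by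
  rcases π.letter_cases hi hiT hl with h | ⟨h1, h2⟩
  · rw [u.2.1 _ h, dist_self]; exact div_nonneg L.ρ_pos.le (by norm_num)
  · exact u.2.2 _ h1 h2

/-- … so every attached plaquette variable is within `ρ` of `ε` (four letters, Lemma 5.1). [cite: Federbush1987PhaseCellIII, Lemma 5.1
(5.2) p. 299; §5.2 p. 302] -/
theorem Peeling.dist_hol_le (π : Peeling P Λ T) (u : π.SmallCfg G L.ρ) {i : Bond d} (hi : i ∈ Λ) (hiT : i ∉ T) :
    dist 1 (wordHol u.1 (π.loop i)) ≤ L.ρ := by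
  refine (LocalLog.dist_one_wordHol_le u.1 _).trans ?_
  have h := List.sum_le_card_nsmul ((π.loop i).map fun l => dist (1 : G) (u.1 l.1)) (L.ρ / 4) (fun x hx => by
    obtain ⟨l, hl, rfl⟩ := List.mem_map.1 hx; exact π.dist_letter_le u hi hiT hl)
  rw [List.length_map] at h
  refine h.trans (le_of_eq ?_)
  simp [plaqLoop]
  ring

/-- Honest plaquette logarithms: `‖A_{∂p(i)}‖ = |g_{∂p(i)}|` on the small-field region. [cite: Federbush1987PhaseCellIII, Lemma 1.0
(1.3) p. 295; §5.2 p. 302] -/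
theorem Peeling.norm_plaq_eq (π : Peeling P Λ T) (u : π.SmallCfg G L.ρ) {i : Bond d} (hi : i ∈ Λ) (hiT : i ∉ T) :
    ‖L.log (wordHol u.1 (π.loop i))‖ = dist 1 (wordHol u.1 (π.loop i)) :=
  L.norm_log _ (π.dist_hol_le u hi hiT)

omit [IsIsometricSMul G G] [IsIsometricSMul Gᵐᵒᵖ G] in
/-- Honest bond logarithms: `‖A_b‖ = |u_b|` on the small-field region. [cite: Federbush1987PhaseCellIII, Lemma 1.0 (1.3) p. 295] -/
theorem Peeling.norm_bond_eq (π : Peeling P Λ T) (u : π.SmallCfg G L.ρ) {b : Bond d} (hb : b ∈ Λ) (hbT : b ∉ T) :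
    ‖L.log (u.1 b)‖ = dist 1 (u.1 b) :=
  L.norm_log _ ((u.2.2 b hb hbT).trans (by linarith [L.ρ_pos]))

/-- **(5.22) to first order, with an explicit quadratic remainder, in every peelable gauge**: on the small-field region
`‖A_{∂p_i} − Σ_α M_{iα}A_{b_α}‖ ≦ (4 + 128Kρ)·Σ_α |A_{b_α}|²` («A_{∂p_i} = Σ_α M_{iα}A_{b_α} (5.22) The right side is the first term in
a power series convergent for small fields») — one BCH step per letter of `∂p_i`. [cite: Federbush1987PhaseCellIII, (5.22) p. 302] -/
theorem Peeling.eq522 (L : LocalLog G 𝔤) (π : Peeling P Λ T) (hF : (Λ \ T).Finite) (u : (π.linearisation L hF).Cfg)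
    (i : (π.linearisation L hF).I) :
    ‖(π.linearisation L hF).plaq u i - ∑ α, (π.linearisation L hF).M i α • (π.linearisation L hF).bond u α‖ ≤
      (4 + 128 * L.K * L.ρ) * ∑ α, ‖(π.linearisation L hF).bond u α‖ ^ 2 := by
  classical
  obtain ⟨i, hi⟩ := i
  obtain ⟨hiΛ, hiT⟩ := (mem_toFinset_iff hF).1 hi
  show ‖L.log (wordHol u.1 (π.loop i)) - ∑ α : ↥hF.toFinset, inc (π.loop i) α.1 • L.log (u.1 α.1)‖ ≤
    (4 + 128 * L.K * L.ρ) * ∑ α : ↥hF.toFinset, ‖L.log (u.1 α.1)‖ ^ 2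
  rw [Finset.sum_coe_sort hF.toFinset (fun α => inc (π.loop i) α • L.log (u.1 α)),
    Finset.sum_coe_sort hF.toFinset (fun α => ‖L.log (u.1 α)‖ ^ 2), sum_inc_smul]
  -- the restricted sum is the full abelian sum (tree letters carry `log ε = 0`)
  have hws : wordSum (fun s => if s ∈ hF.toFinset then L.log (u.1 s) else 0) (π.loop i) =
      wordSum (fun s => L.log (u.1 s)) (π.loop i) := by
    refine wordSum_congr _ fun l hl => ?_
    rcases π.letter_cases hiΛ hiT hl with h | h
    · have hnot : l.1 ∉ hF.toFinset := fun hm => ((mem_toFinset_iff hF).1 hm).2 h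
      rw [if_neg hnot, u.2.1 _ h, L.log_one]
    · rw [if_pos ((mem_toFinset_iff hF).2 h)]
  rw [hws]
  -- total size of the four letters
  set t : ℝ := ((π.loop i).map fun l => dist (1 : G) (u.1 l.1)).sum with ht
  have hK := L.K_nonneg
  have hρ := L.ρ_pos
  have hlen : (π.loop i).length = 4 := by simp [plaqLoop]
  have htρ : t ≤ L.ρ := by
    have h := List.sum_le_card_nsmul ((π.loop i).map fun l => dist (1 : G) (u.1 l.1)) (L.ρ / 4) (fun x hx => by
      obtain ⟨l, hl, rfl⟩ := List.mem_map.1 hx; exact π.dist_letter_le u hiΛ hiT hl)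
    rw [List.length_map, hlen] at h
    refine h.trans (le_of_eq ?_); simp; ring
  have ht0 : 0 ≤ t := List.sum_nonneg (by
    intro x hx; obtain ⟨l, -, rfl⟩ := List.mem_map.1 hx; exact dist_nonneg)
  obtain ⟨-, hbch⟩ := L.norm_log_wordHol_sub_wordSum_le u.1 (π.loop i) t le_rfl htρ
  rw [hlen] at hbch
  -- `t² ≦ 4 Σ_{letters} |u|²` and the letters' squares are among the free bonds' squares
  have hsq : t ^ 2 ≤ 4 * ((π.loop i).map fun l => dist (1 : G) (u.1 l.1) ^ 2).sum := by
    rw [ht]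
    simp only [plaqLoop, List.map_cons, List.map_nil, List.sum_cons, List.sum_nil, add_zero]
    nlinarith [sq_nonneg (dist (1 : G) (u.1 ((π.plaq i).1, (π.plaq i).2.1)) - dist 1 (u.1 ((π.plaq i).1 + ev (π.plaq i).2.1, (π.plaq i).2.2))),
      sq_nonneg (dist (1 : G) (u.1 ((π.plaq i).1, (π.plaq i).2.1)) - dist 1 (u.1 ((π.plaq i).1 + ev (π.plaq i).2.2, (π.plaq i).2.1))),
      sq_nonneg (dist (1 : G) (u.1 ((π.plaq i).1, (π.plaq i).2.1)) - dist 1 (u.1 ((π.plaq i).1, (π.plaq i).2.2))),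
      sq_nonneg (dist (1 : G) (u.1 ((π.plaq i).1 + ev (π.plaq i).2.1, (π.plaq i).2.2)) - dist 1 (u.1 ((π.plaq i).1 + ev (π.plaq i).2.2, (π.plaq i).2.1))),
      sq_nonneg (dist (1 : G) (u.1 ((π.plaq i).1 + ev (π.plaq i).2.1, (π.plaq i).2.2)) - dist 1 (u.1 ((π.plaq i).1, (π.plaq i).2.2))),
      sq_nonneg (dist (1 : G) (u.1 ((π.plaq i).1 + ev (π.plaq i).2.2, (π.plaq i).2.1)) - dist 1 (u.1 ((π.plaq i).1, (π.plaq i).2.2)))]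
  have hsides : ((π.loop i).map fun l => dist (1 : G) (u.1 l.1) ^ 2).sum ≤ ∑ α ∈ hF.toFinset, ‖L.log (u.1 α)‖ ^ 2 := by
    -- the squares as a function on bonds, vanishing on the tree
    set g : Bond d → ℝ := fun s => dist (1 : G) (u.1 s) ^ 2 with hg
    have hgT : ∀ s ∈ T, g s = 0 := fun s hs => by rw [hg]; simp [u.2.1 s hs]
    have hg0 : ∀ s, 0 ≤ g s := fun s => sq_nonneg _
    have hμν := π.plaq_ne i hiΛ hiT
    set z := (π.plaq i).1
    set μ := (π.plaq i).2.1
    set ν := (π.plaq i).2.2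
    -- the four distinct sides
    have d12 : ((z, μ) : Bond d) ≠ (z + ev μ, ν) := fun h => hμν (congrArg Prod.snd h)
    have d13 : ((z, μ) : Bond d) ≠ (z + ev ν, μ) := fun h => (add_ev_ne z ν) (congrArg Prod.fst h).symm
    have d14 : ((z, μ) : Bond d) ≠ (z, ν) := fun h => hμν (congrArg Prod.snd h)
    have d23 : ((z + ev μ, ν) : Bond d) ≠ (z + ev ν, μ) := fun h => hμν.symm (congrArg Prod.snd h)
    have d24 : ((z + ev μ, ν) : Bond d) ≠ (z, ν) := fun h => add_ev_ne z μ (congrArg Prod.fst h)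
    have d34 : ((z + ev ν, μ) : Bond d) ≠ (z, ν) := fun h => hμν (congrArg Prod.snd h)
    set S4 : Finset (Bond d) := {(z, μ), (z + ev μ, ν), (z + ev ν, μ), (z, ν)} with hS4
    have hsum4 : ((π.loop i).map fun l => dist (1 : G) (u.1 l.1) ^ 2).sum = ∑ s ∈ S4, g s := by
      rw [hS4, Finset.sum_insert (by simp [d12, d13, d14]), Finset.sum_insert (by simp [d23, d24]),
        Finset.sum_pair d34]
      simp only [plaqLoop, List.map_cons, List.map_nil, List.sum_cons, List.sum_nil, add_zero, hg]
      ring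
    have hS4sub : ∀ s ∈ S4, s ∈ T ∨ (s ∈ Λ ∧ s ∉ T) := by
      intro s hs
      rw [hS4] at hs
      simp only [Finset.mem_insert, Finset.mem_singleton] at hs
      obtain ⟨l, hl, rfl⟩ := (mem_plaqLoop_iff (z := z) (μ := μ) (ν := ν) (b := s)).2 hs
      exact π.letter_cases hiΛ hiT hl
    rw [hsum4, ← Finset.sum_filter_add_sum_filter_not S4 (fun s => s ∈ hF.toFinset)]
    have hzero : ∑ s ∈ S4.filter (fun s => s ∉ hF.toFinset), g s = 0 :=
      Finset.sum_eq_zero fun s hs => by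
        obtain ⟨hs, hnot⟩ := Finset.mem_filter.1 hs
        rcases hS4sub s hs with h | h
        · exact hgT s h
        · exact absurd ((mem_toFinset_iff hF).2 h) hnot
    rw [hzero, add_zero]
    calc ∑ s ∈ S4.filter (fun s => s ∈ hF.toFinset), g s ≤ ∑ s ∈ hF.toFinset, g s :=
          Finset.sum_le_sum_of_subset_of_nonneg (fun s hs => (Finset.mem_filter.1 hs).2) fun s _ _ => hg0 s
      _ = ∑ α ∈ hF.toFinset, ‖L.log (u.1 α)‖ ^ 2 := Finset.sum_congr rfl fun s hs => by
          obtain ⟨h1, h2⟩ := (mem_toFinset_iff hF).1 hs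
          rw [hg, π.norm_bond_eq u h1 h2]
  calc ‖L.log (wordHol u.1 (π.loop i)) - wordSum (fun s => L.log (u.1 s)) (π.loop i)‖
      ≤ t ^ 2 + 8 * L.K * (4 : ℕ) * t ^ 3 := hbch
    _ ≤ (1 + 32 * L.K * L.ρ) * t ^ 2 := by
        have h3 : t ^ 3 ≤ L.ρ * t ^ 2 := by
          rw [pow_succ, mul_comm]; exact mul_le_mul_of_nonneg_right htρ (sq_nonneg _)
        push_cast; nlinarith [mul_le_mul_of_nonneg_left h3 (by positivity : (0 : ℝ) ≤ 32 * L.K)]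
    _ ≤ (4 + 128 * L.K * L.ρ) * ∑ α ∈ hF.toFinset, ‖L.log (u.1 α)‖ ^ 2 := by
        have hκ : 0 ≤ 1 + 32 * L.K * L.ρ := by positivity
        nlinarith [mul_le_mul_of_nonneg_left (hsq.trans (mul_le_mul_of_nonneg_left hsides (by norm_num))) hκ]

omit [IsIsometricSMul G G] [IsIsometricSMul Gᵐᵒᵖ G] in
/-- **(5.23) inverts (5.22): `Σ_α M_{iα}N_{αj} = δ_{ij}`** — the abelian solution of the peeling reproduces every attached plaquette
variable («Since the Balaban gauge provides a complete gauge specification we have … A_{b_α} = Σ_{i∈J} N_{αi}A_{∂p_i} (5.23)»).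
[cite: Federbush1987PhaseCellIII, (5.22)–(5.23) p. 302] -/
theorem Peeling.sum_M_mul_N (L : LocalLog G 𝔤) (π : Peeling P Λ T) (hF : (Λ \ T).Finite) (i j : (π.linearisation L hF).I) :
    ∑ α, (π.linearisation L hF).M i α * (π.linearisation L hF).Nmat α j = if i.1 = j.1 then 1 else 0 := by
  classical
  obtain ⟨i, hi⟩ := i
  obtain ⟨j, hj⟩ := j
  obtain ⟨hiΛ, hiT⟩ := (mem_toFinset_iff hF).1 hi
  show ∑ α : ↥hF.toFinset, inc (π.loop i) α.1 * π.N α.1 j = if i = j then 1 else 0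
  rw [Finset.sum_coe_sort hF.toFinset (fun α => inc (π.loop i) α * π.N α j)]
  have h := sum_inc_smul hF.toFinset (π.loop i) (fun α => π.N α j)
  simp only [smul_eq_mul] at h
  rw [h]
  have hws : wordSum (fun s => if s ∈ hF.toFinset then π.N s j else 0) (π.loop i) = wordSum (fun s => π.N s j) (π.loop i) := by
    refine wordSum_congr _ fun l _ => ?_
    split_ifs with hm
    · rfl
    · rw [π.N_of_not (fun h => hm ((mem_toFinset_iff hF).2 h))]
  rw [hws, π.wordSum_N_loop hiΛ hiT j]
  rcases eq_or_ne i j with rfl | hne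
  · simp
  · rw [if_neg hne.symm, if_neg hne]

omit [IsIsometricSMul G G] [IsIsometricSMul Gᵐᵒᵖ G] in
/-- **… and `Σ_i N_{αi}M_{iβ} = δ_{αβ}`**: both index sets being the non-tree bonds, `N` is the two-sided inverse of `M` (a one-sided
inverse of a square matrix is two-sided). [cite: Federbush1987PhaseCellIII, (5.22)–(5.23) p. 302] -/
theorem Peeling.sum_N_mul_M (L : LocalLog G 𝔤) (π : Peeling P Λ T) (hF : (Λ \ T).Finite) (α β : (π.linearisation L hF).B) :
    ∑ i, (π.linearisation L hF).Nmat α i * (π.linearisation L hF).M i β = if α.1 = β.1 then 1 else 0 := by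
  classical
  let Mm : Matrix (↥hF.toFinset) (↥hF.toFinset) ℝ := fun i γ => inc (π.loop i.1) γ.1
  let Nm : Matrix (↥hF.toFinset) (↥hF.toFinset) ℝ := fun γ i => π.N γ.1 i.1
  have hMN : Mm * Nm = 1 := by
    ext i j
    rw [Matrix.mul_apply, Matrix.one_apply]
    have h := π.sum_M_mul_N L hF i j
    by_cases hij : i = j
    · subst hij; rw [if_pos rfl]; rw [if_pos rfl] at h; exact h
    · have hij' : i.1 ≠ j.1 := fun e => hij (Subtype.ext e)
      rw [if_neg hij]; rw [if_neg hij'] at h; exact h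
  have hNM : Nm * Mm = 1 := mul_eq_one_comm.mp hMN
  obtain ⟨a, ha⟩ := α
  obtain ⟨b, hb⟩ := β
  have h := congrFun (congrFun hNM ⟨a, ha⟩) ⟨b, hb⟩
  rw [Matrix.mul_apply, Matrix.one_apply] at h
  show ∑ i : ↥hF.toFinset, π.N a i.1 * inc (π.loop i.1) b = if a = b then 1 else 0
  by_cases hab : a = b
  · subst hab; rw [if_pos rfl]; rw [if_pos rfl] at h; exact h
  · have hab' : (⟨a, ha⟩ : ↥hF.toFinset) ≠ ⟨b, hb⟩ := fun e => hab (congrArg Subtype.val e)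
    rw [if_neg hab]; rw [if_neg hab'] at h; exact h

/-- **(5.24) IN EVERY PEELABLE GAUGE** — «3), and 4) specify a gauge. In this gauge we deduce an inequality like (5.24)» (§5.3 5)
p. 304): for every peeling `π` of `(P, Λ, T)` with finitely many non-tree bonds and every group `G` with §1's chart data, the
(5.22)–(5.24) carrier of `π` satisfies the decl of record `Eq524Le` of row F3.Eq5.24: there are `c` and `ρ′ > 0` («depending on N»:
here on the peeling through its maximal rank `R` and its number `|B|` of non-tree bonds — `ρ′ = ρ/(a_{R+1}(|B|+1))`,
`c = e_{R+1}(1+32Kρ)·|B|`) such that `|A_{∂p_i}| < ρ′ ∀ i ⇒ ‖A_{b_α} − Σ_i N_{αi}A_{∂p_i}‖ ≦ cΣ_i|A_{∂p_i}|²` for every non-tree `α`.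
[cite: Federbush1987PhaseCellIII, (5.24) p. 302; §5.3 5) p. 304; §5.3 p. 303 «A number of constants arise … Some of the
constants will depend on N»] -/
theorem Peeling.eq524Le (L : LocalLog G 𝔤) (π : Peeling P Λ T) (hF : (Λ \ T).Finite) : (π.linearisation L hF).Eq524Le := by
  classical
  set Fs := hF.toFinset with hFs_def
  have hFs : ∀ b, b ∈ Fs ↔ b ∈ Λ ∧ b ∉ T := fun b => mem_toFinset_iff hF
  set n : ℕ := Fs.sup π.rank + 1 with hn
  set κ : ℝ := 1 + 32 * L.K * L.ρ with hκ
  have hK := L.K_nonneg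
  have hρ := L.ρ_pos
  have hκ0 : 0 ≤ κ := by rw [hκ]; positivity
  have han : 1 ≤ aC n := one_le_aC_succ _
  refine ⟨eC κ n * Fs.card, L.ρ / (aC n * (Fs.card + 1)), by positivity, fun u hu α => ?_⟩
  obtain ⟨α, hα⟩ := α
  obtain ⟨hαΛ, hαT⟩ := (hFs α).1 hα
  -- the plaquette variables and their total size
  set A : Bond d → 𝔤 := fun i => L.log (wordHol u.1 (π.loop i)) with hA
  show ‖L.log (u.1 α) - ∑ i : ↥Fs, π.N α i.1 • A i.1‖ ≤ eC κ n * Fs.card * ∑ i : ↥Fs, ‖A i.1‖ ^ 2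
  rw [Finset.sum_coe_sort Fs (fun i => π.N α i • A i), Finset.sum_coe_sort Fs (fun i => ‖A i‖ ^ 2)]
  set S : ℝ := ∑ i ∈ Fs, ‖A i‖ with hS
  have hS0 : 0 ≤ S := Finset.sum_nonneg fun i _ => norm_nonneg _
  have hAeq : ∀ i ∈ Fs, ‖A i‖ = dist 1 (wordHol u.1 (π.loop i)) := fun i hi =>
    π.norm_plaq_eq u ((hFs i).1 hi).1 ((hFs i).1 hi).2
  have hSi : ∀ i ∈ Fs, dist 1 (wordHol u.1 (π.loop i)) ≤ S := fun i hi => by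
    rw [← hAeq i hi]; exact Finset.single_le_sum (fun j _ => norm_nonneg (A j)) hi
  -- `|A_{∂p_i}| < ρ′` for all `i` makes `a_n S ≦ ρ`
  have hu' : ∀ i ∈ Fs, ‖A i‖ ≤ L.ρ / (aC n * (Fs.card + 1)) := fun i hi => (hu ⟨i, hi⟩).le
  have hSle : S ≤ Fs.card * (L.ρ / (aC n * (Fs.card + 1))) := by
    have h := Finset.sum_le_card_nsmul Fs (fun i => ‖A i‖) _ hu'
    rwa [nsmul_eq_mul] at h
  have hnS : aC n * S ≤ L.ρ := by
    have hc : (0 : ℝ) ≤ Fs.card := Nat.cast_nonneg _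
    calc aC n * S ≤ aC n * (Fs.card * (L.ρ / (aC n * (Fs.card + 1)))) := mul_le_mul_of_nonneg_left hSle (aC_nonneg n)
      _ = L.ρ * (Fs.card / (Fs.card + 1)) := by field_simp
      _ ≤ L.ρ * 1 := mul_le_mul_of_nonneg_left (by rw [div_le_one (by positivity)]; linarith) hρ.le
      _ = L.ρ := mul_one _
  -- the estimate of §4 at the bond `α`
  have hrank : π.rank α < n := Nat.lt_succ_of_le (Finset.le_sup (f := π.rank) hα)
  obtain ⟨-, hmain⟩ := π.norm_log_sub_lin_le L Fs hFs u.1 u.2.1 hS0 hSi n hnS α hαΛ hrank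
  -- `S² ≦ |B|·Σ_i |A_{∂p_i}|²`
  have hCS : S ^ 2 ≤ Fs.card * ∑ i ∈ Fs, ‖A i‖ ^ 2 := sq_sum_le_card_mul_sum_sq
  calc ‖L.log (u.1 α) - ∑ i ∈ Fs, π.N α i • A i‖ ≤ eC κ n * S ^ 2 := hmain
    _ ≤ eC κ n * (Fs.card * ∑ i ∈ Fs, ‖A i‖ ^ 2) := mul_le_mul_of_nonneg_left hCS (eC_nonneg hκ0 n)
    _ = eC κ n * Fs.card * ∑ i ∈ Fs, ‖A i‖ ^ 2 := (mul_assoc _ _ _).symm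

/-- **(5.24) in every peelable gauge for [F3]'s own `G = SU(2)`** (unit quaternions, great-circle distance, `ρ = 1/4`, `K = 2`:
p32's `SU2.localLog`). [cite: Federbush1987PhaseCellIII, (5.24) p. 302; §1 p. 294–295; §5.3 5) p. 304] -/
theorem Peeling.eq524Le_SU2 (π : Peeling P Λ T) (hF : (Λ \ T).Finite) : (π.linearisation SU2.localLog hF).Eq524Le :=
  π.eq524Le SU2.localLog hF

/-- **(5.24) in every peelable gauge for `G = U(N)`, every `N`** (Frobenius data, p12/p32's `UN.localLog`: Bałaban's groups).
[cite: Federbush1987PhaseCellIII, (5.24) p. 302; §5.3 5) p. 304] -/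
theorem Peeling.eq524Le_UN (N : ℕ) (π : Peeling P Λ T) (hF : (Λ \ T).Finite) :
    (π.linearisation (UN.localLog (N := N)) hF).Eq524Le :=
  π.eq524Le UN.localLog hF

end Carrier

end PeelingObservation

/-! ## §6 (v1.1) The estimate with WEIGHTS (the Lie-algebra twin of `Peeling.dist_le_of_weight`) and the comb: linearisation error
cubic in the height -/

namespace PeelingObservation

open scoped BigOperators
open LatticeContour SimplyConnectedBox CombGaugeObservation

variable {d : ℕ}

section Weights

variable {G : Type*} [Group G] [MetricSpace G] [IsIsometricSMul G G] [IsIsometricSMul Gᵐᵒᵖ G]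
variable {𝔤 : Type*} [NormedAddCommGroup 𝔤] [NormedSpace ℝ 𝔤] (L : LocalLog G 𝔤)
variable {P : Set (LatticeContour.Plaq d)} {Λ T : Set (Bond d)} (π : Peeling P Λ T)

/-- **The peeling linearisation estimate, weighted form.**  Let `π` peel `Λ` relative to `(T, P)`, `u ≡ ε` on `T`, `|g_{∂p(i)}| ≦ S` on
the attached plaquettes; let `W, E ≧ 0` on `T` be weights with `S + Σ_{other sides s of p(b)} W(s) ≦ W(b) ≦ ρ` and
`κW(b)² + Σ_{other sides} E(s) ≦ E(b)` (`κ = 1 + 32Kρ`) for every non-tree `b ∈ Λ`.  Then `|u_b| ≦ W(b)` and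
`‖log u_b − Σ_i N_{bi} log g_{∂p(i)}‖ ≦ E(b)` on `Λ` — §4 is the case `W = a_{rank+1}S`, `E = e_{rank+1}S²`; the comb below has
`W = height·S`, `E = κ·height³·S²`. [cite: Federbush1987PhaseCellIII, (5.22)–(5.24) p. 302; §5.3 2)–5) pp. 303–304] -/
theorem Peeling.norm_log_sub_lin_le_of_weight (Fs : Finset (Bond d)) (hFs : ∀ b, b ∈ Fs ↔ b ∈ Λ ∧ b ∉ T)
    (u : Bond d → G) (hg : ∀ b ∈ T, u b = 1) {S : ℝ} (hS : ∀ i ∈ Fs, dist 1 (wordHol u (π.loop i)) ≤ S)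
    (W E : Bond d → ℝ) (hWT : ∀ b ∈ T, 0 ≤ W b) (hET : ∀ b ∈ T, 0 ≤ E b)
    (hW : ∀ b ∈ Λ, b ∉ T → S + ((π.others b).map fun s => W s.1).sum ≤ W b) (hWρ : ∀ b ∈ Λ, b ∉ T → W b ≤ L.ρ)
    (hE : ∀ b ∈ Λ, b ∉ T → (1 + 32 * L.K * L.ρ) * W b ^ 2 + ((π.others b).map fun s => E s.1).sum ≤ E b) :
    ∀ b ∈ Λ, dist 1 (u b) ≤ W b ∧ ‖L.log (u b) - π.lin Fs (fun i => L.log (wordHol u (π.loop i))) b‖ ≤ E b := by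
  set κ : ℝ := 1 + 32 * L.K * L.ρ with hκ
  have hK := L.K_nonneg
  have hρ0 := L.ρ_pos
  set A : Bond d → 𝔤 := fun i => L.log (wordHol u (π.loop i)) with hA
  have htree : ∀ b ∈ T, dist 1 (u b) ≤ W b ∧ ‖L.log (u b) - π.lin Fs A b‖ ≤ E b := by
    intro b hbT
    rw [hg b hbT, dist_self, L.log_one, π.lin_of_not Fs A (fun h => h.2 hbT), sub_zero, norm_zero]
    exact ⟨hWT b hbT, hET b hbT⟩
  have key : ∀ n : ℕ, ∀ b ∈ Λ, π.rank b < n → dist 1 (u b) ≤ W b ∧ ‖L.log (u b) - π.lin Fs A b‖ ≤ E b := by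
    intro n
    induction n with
    | zero => intro b _ h; exact absurd h (Nat.not_lt_zero _)
    | succ n ih =>
      intro b hb hbn
      by_cases hbT : b ∈ T
      · exact htree b hbT
      have hbF : b ∈ Fs := (hFs b).2 ⟨hb, hbT⟩
      have hμν := π.plaq_ne b hb hbT
      have hl := π.letter_mem hb hbT
      have hside : ∀ s ∈ π.others b, dist 1 (u s.1) ≤ W s.1 ∧ ‖L.log (u s.1) - π.lin Fs A s.1‖ ≤ E s.1 := by
        intro s hs
        obtain ⟨hs, hne⟩ := mem_otherLetters_iff.1 hs
        rcases π.lower b hb hbT s hs hne with hT | ⟨hΛ, hlt⟩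
        · exact htree s.1 hT
        · exact ih s.1 hΛ (by omega)
      have hsum1 : ((π.others b).map fun s => dist (1 : G) (u s.1)).sum ≤ ((π.others b).map fun s => W s.1).sum :=
        List.sum_le_sum fun s hs => (hside s hs).1
      have ht : dist 1 (wordHol u (π.loop b)) + ((π.others b).map fun s => dist (1 : G) (u s.1)).sum ≤ W b := by
        have := hS b hbF; have := hW b hb hbT; linarith
      obtain ⟨hdist, herr⟩ := norm_log_side_sub_le L u hμν hl (W b) ht (hWρ b hb hbT)
      rw [Peeling.letter_fst] at hdist herr
      refine ⟨hdist, ?_⟩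
      have hlin := π.lin_eq Fs A hb hbT hbF
      have hsplit : L.log (u b) - π.lin Fs A b =
          (L.log (u b) - lsgn (π.letter b) • (A b - wordSum (fun s => L.log (u s)) (π.others b))) +
            lsgn (π.letter b) • wordSum (π.lin Fs A - fun s => L.log (u s)) (π.others b) := by
        rw [hlin, wordSum_sub_pointwise]; simp only [smul_sub]; abel
      rw [hsplit]
      have hsum2 : ((π.others b).map fun s => ‖(π.lin Fs A - fun s => L.log (u s)) s.1‖).sum ≤
          ((π.others b).map fun s => E s.1).sum :=
        List.sum_le_sum fun s hs => by rw [Pi.sub_apply, norm_sub_rev]; exact (hside s hs).2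
      have hterm2 : ‖lsgn (π.letter b) • wordSum (π.lin Fs A - fun s => L.log (u s)) (π.others b)‖ ≤
          ((π.others b).map fun s => E s.1).sum := by
        rw [norm_smul, Real.norm_eq_abs, abs_lsgn, one_mul]
        exact (norm_wordSum_le_sum _ _).trans hsum2
      have hW0 : 0 ≤ W b := by
        have h0 : 0 ≤ dist 1 (wordHol u (π.loop b)) := dist_nonneg
        have h1 : 0 ≤ ((π.others b).map fun s => dist (1 : G) (u s.1)).sum :=
          List.sum_nonneg (by intro x hx; obtain ⟨l, -, rfl⟩ := List.mem_map.1 hx; exact dist_nonneg)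
        linarith
      have hterm1 : ‖L.log (u b) - lsgn (π.letter b) • (A b - wordSum (fun s => L.log (u s)) (π.others b))‖ ≤
          κ * W b ^ 2 := by
        refine herr.trans ?_
        have h3 : W b ^ 3 ≤ L.ρ * W b ^ 2 := by
          rw [pow_succ, mul_comm]; exact mul_le_mul_of_nonneg_right (hWρ b hb hbT) (sq_nonneg _)
        rw [hκ]; nlinarith [mul_le_mul_of_nonneg_left h3 (by positivity : (0 : ℝ) ≤ 32 * L.K)]
      refine (norm_add_le _ _).trans ?_
      have := hE b hb hbT
      linarith
  exact fun b hb => key _ b hb (Nat.lt_succ_self _)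

end Weights

/-! ### The comb: `|u_b| ≦ height(b)·S` (Bałaban's (45)–(46) again) and `‖A_b − A_b^{lin}‖ ≦ κ·height(b)³·S²` -/

section Comb

variable {lo hi : LatticeContour.Site d}

/-- Across the attached plaquette of a non-comb bond `b = ⟨x, x + e_μ⟩` (top direction `ν`) the other three letters are two comb
bonds and the bond `⟨x − e_ν, x − e_ν + e_μ⟩` one level lower: for any `F` vanishing on the comb,
`Σ_{other letters} F = F⟨x − e_ν, x − e_ν + e_μ⟩`. [cite: Federbush1987PhaseCellIII, §5.3 2)–3) p. 303; Balaban1985Averaging, (45) p. 24] -/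
theorem comb_others_sum {x : LatticeContour.Site d} {μ : Fin d} (hb : ((x, μ) : Bond d) ∈ boxBonds lo hi)
    (hT : ((x, μ) : Bond d) ∉ combTree lo hi) (F : Bond d → ℝ) (hF : ∀ s ∈ combTree lo hi, F s = 0) :
    ∃ ν : Fin d, μ < ν ∧ lo ν < x ν ∧
      (((combPeeling lo hi).others (x, μ)).map fun s => F s.1).sum = F (x - ev ν, μ) ∧
      height lo ((x - ev ν, μ) : Bond d) + 1 = height lo ((x, μ) : Bond d) := by
  have h0 : height lo ((x, μ) : Bond d) ≠ 0 := fun h0 => hT (mem_combTree_of_height_eq_zero hb h0)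
  obtain ⟨ν, hp, hμν, hne, htop⟩ := combPlaq_spec h0
  have hν : lo ν < x ν := lt_of_le_of_ne (mem_boxSites.1 (fst_mem_boxSites hb) ν).1 (Ne.symm hne)
  refine ⟨ν, hμν, hν, ?_, height_lower lo hμν hν⟩
  have hplaq : (combPeeling lo hi).plaq (x, μ) = (x - ev ν, μ, ν) := hp
  have hothers : (combPeeling lo hi).others (x, μ) =
      [((x - ev ν, μ), true), ((x - ev ν + ev μ, ν), true), ((x - ev ν, ν), false)] := by
    show otherLetters ((combPeeling lo hi).plaq (x, μ)).1 ((combPeeling lo hi).plaq (x, μ)).2.1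
      ((combPeeling lo hi).plaq (x, μ)).2.2 (x, μ) = _
    rw [hplaq]
    have := otherLetters_third (x - ev ν) (ne_of_lt hμν)
    rwa [sub_ev_add_ev] at this
  rw [hothers]
  simp only [List.map_cons, List.map_nil, List.sum_cons, List.sum_nil, add_zero]
  rw [hF _ (lowerShiftSide_mem_combTree hb hμν hν htop), hF _ (lowerSide_mem_combTree hb hν htop), add_zero, add_zero]

variable {G : Type*} [Group G] [MetricSpace G] [IsIsometricSMul G G] [IsIsometricSMul Gᵐᵒᵖ G]
variable {𝔤 : Type*} [NormedAddCommGroup 𝔤] [NormedSpace ℝ 𝔤] (L : LocalLog G 𝔤)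

/-- **The comb (Bałaban axial) gauge: linearisation error CUBIC IN THE HEIGHT.**  For `u ≡ ε` on the comb of the box `[lo, hi]` with
attached plaquette variables `|g_{∂p(i)}| ≦ S` and `H·S ≦ ρ`, `H = Σ_ν (hi_ν − lo_ν)` (a bound for every height): every bond `b` of
the box has `|u_b| ≦ height(b)·S` (the Lipschitz form `PeelingEstimate.absG_le_height_mul_of_combGauge`, = [Balaban1985Averaging]
(45)–(46)) and `‖log u_b − Σ_i N_{bi} log g_{∂p(i)}‖ ≦ (1 + 32Kρ)·height(b)³·S²` — polynomial constants in the comb gauge, as in p32's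
strip/block instances (`c = 3m²`). [cite: Federbush1987PhaseCellIII, (5.24) p. 302; §5.3 3) p. 303; Balaban1985Averaging, (45)–(46) p. 24–25] -/
theorem norm_log_sub_lin_le_combGauge (Fs : Finset (Bond d)) (hFs : ∀ b, b ∈ Fs ↔ b ∈ boxBonds lo hi ∧ b ∉ combTree lo hi)
    (u : Bond d → G) (hg : ∀ b ∈ combTree lo hi, u b = 1) {S : ℝ} (hS0 : 0 ≤ S)
    (hS : ∀ i ∈ Fs, dist 1 (wordHol u ((combPeeling lo hi).loop i)) ≤ S)
    (hρ : (∑ ν : Fin d, ((hi ν - lo ν).toNat : ℝ)) * S ≤ L.ρ) :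
    ∀ b ∈ boxBonds lo hi, dist 1 (u b) ≤ height lo b * S ∧
      ‖L.log (u b) - (combPeeling lo hi).lin Fs (fun i => L.log (wordHol u ((combPeeling lo hi).loop i))) b‖ ≤
        (1 + 32 * L.K * L.ρ) * (height lo b : ℝ) ^ 3 * S ^ 2 := by
  have hK := L.K_nonneg
  have hρ0 := L.ρ_pos
  have hκ : 0 ≤ 1 + 32 * L.K * L.ρ := by positivity
  have h := (combPeeling lo hi).norm_log_sub_lin_le_of_weight L Fs hFs u hg hS
    (fun b => height lo b * S) (fun b => (1 + 32 * L.K * L.ρ) * (height lo b : ℝ) ^ 3 * S ^ 2)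
    (fun b _ => by positivity) (fun b _ => by positivity) ?_ ?_ ?_
  · exact h
  · -- `S + Σ_{other sides} height·S = height(b)·S`
    rintro ⟨x, μ⟩ hb hbT
    obtain ⟨ν, -, -, hsum, hh⟩ := comb_others_sum hb hbT (fun s => height lo s * S)
      (fun s hs => by rw [height_eq_zero_of_mem_combTree hs, Nat.cast_zero, zero_mul])
    rw [hsum, ← hh]; push_cast; linarith
  · -- `height(b)·S ≦ H·S ≦ ρ`
    rintro b hb -
    exact (mul_le_mul_of_nonneg_right (by exact_mod_cast height_le_sum hb) hS0).trans hρ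
  · -- `κ(hS)² + κ(h−1)³S² ≦ κh³S²` since `h² + (h−1)³ ≦ h³` for `h ≧ 1`
    rintro ⟨x, μ⟩ hb hbT
    obtain ⟨ν, -, -, hsum, hh⟩ := comb_others_sum hb hbT (fun s => (1 + 32 * L.K * L.ρ) * (height lo s : ℝ) ^ 3 * S ^ 2)
      (fun s hs => by rw [height_eq_zero_of_mem_combTree hs, Nat.cast_zero]; ring)
    rw [hsum, ← hh]
    set m : ℝ := (height lo ((x - ev ν, μ) : Bond d) : ℝ) with hm
    have hm0 : 0 ≤ m := Nat.cast_nonneg _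
    push_cast
    have hpoly : (m + 1) ^ 2 + m ^ 3 ≤ (m + 1) ^ 3 := by nlinarith [sq_nonneg m]
    have hS2 : 0 ≤ S ^ 2 := sq_nonneg S
    nlinarith [mul_le_mul_of_nonneg_left (mul_le_mul_of_nonneg_right hpoly hS2) hκ]

end Comb

end PeelingObservation

end

end Literature.MathematicalPhysics.QuantumFieldTheory.Federbush1986
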